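import Literature.NumberTheory.DiophantineGeometry.ShuteFourSquarefulConstant
import Literature.NumberTheory.DiophantineGeometry.ShuteFourSquarefulProofs

/-!
# Shute (2021): Theorem 1.1 from Prop. 3.1 and the circle-method input (§5 assembled)

Seventh companion to `ShuteFourSquareful.lean` by this route (named fact
`Literature.NumberTheory.DiophantineGeometry.Shute2021_theorem11` = Theorem 1.1 of A. Shute,
*Sums of four squareful numbers*, arXiv:2104.06966: `N(B) = cB + O_ε(B^{734/735+ε})`, `c > 0`).
Everything here is PROVED. Main result:

* `Shute2021.theorem11_of_circleMethod (h31 : Shute2021_prop31) (𝔠) (h1 : CoeffBound 𝔠)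
  (h2 : CircleMethodInput 𝔠) (hc : 0 < cConst 𝔠) : Shute2021_theorem11`, and the same from
  `Shute2021_prop32` (`Shute2021.theorem11_of_prop32_and_circleMethod`, through
  `Shute2021_prop32.prop31`).

That is: Theorem 1.1 follows from Prop. 3.1 (named fact, reduced to Prop. 3.2 in
`ShuteFourSquarefulProofs.lean`; the printed proof of Prop. 3.2 is incomplete, see
`ShuteFourSquareful.lean`), from Theorem 4.2 for the counts `N_𝐚(B)` with any main-term coefficient
`𝔠(𝐚)` obeying Lemma 4.15 (in the paper `𝔠(𝐚) = 𝔖_𝐚σ_∞(𝛆)`), and from the positivity of the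
resulting constant (Lemma 5.5). Together with the companions this kernel-checks all of §3's
deduction of Prop. 3.1 and all of §5 except Lemma 5.5; what is not formalized is §4 (Heath-Brown's
`δ`-method: Theorem 4.2, Lemma 4.15), `c > 0`, and Prop. 3.2.

The route (`Shute2021.truncated_asymptotic`, the hypothesis `hmain` of
`Shute2021.mainCount_sub_linear_le_of_truncated'`): for `B ≥ 128` and `1 ≤ D ≤ B^{4/245}`, write
`N(D, B) = Σ_{(d,𝐲) ∈ 𝒟×𝒴} μ(d) N⁺_{𝐬²𝐲³}(B)` (`Shute2021.mainCountTrunc_eq_sum_pairs`), split at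
`d₀ ≤ S₀ = B^{1/4}D`;
* for `d₀ ≤ S₀`, `N⁺_{𝐬²𝐲³}(B) = N_{𝐚′}(B′)/16` with `B′ = ⌊B/d₀²⌋ ≥ 1` and `|A′| ≤ D¹¹ ≤ B′^{4/7}`
  (`Shute2021.applicability`), so Theorem 4.2 applies (`Shute2021.local_estimate`: error
  `≤ C(B/d₀²)^{41/42+ε} + C` per pair, the second `C` from `|B′ − B/d₀²| ≤ 1`); summed, these give
  `≪ B^{41/42+ε} D^{1+2δ} + B^{1/4} D^{2+2δ}` (`Shute2021.sum_local_le`; this is Lemma 5.4 in the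
  form `E₂(D) ≪ D^{1+ε}`, the paper's `D^{11/8}` being lossy, and `#𝒴 ≪ D^{1+δ}`);
* for `d₀ > S₀`, the trivial bound `N⁺ ≤ (B/d₀²)^{3/2}` gives `≪ B^{3/2} S₀^{-2+κ} D^{1+2δ}`
  (`Shute2021.sum_tail_posQuadCount_le`) — the truncation of the `s₀`-sum that the paper omits
  (Theorem 4.2 needs `|S²Y³| ≤ (B/s₀²)^{4/7}`; the sum over all `s₀` of (5.9) diverges as printed);
* the main terms complete to `cB` up to `B · (Σ_{|Y| > D} + Σ_{d₀ > S₀}) |cTerm| ≪ B(D^{-η} + S₀^{κ-1})`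
  (`Shute2021.const_tail_le`, Lemma 5.3);
* the exponents combine to `≪ B^{1+ε}D^{-1/4} + B^{41/42+ε}D^{11/8}` (`Shute2021.expo_T1`–`expo_T5`),
  `B < 128` is a finite check (`Shute2021.smallConst`), and the final paragraph of §5 with
  `D = ⌊B^{4/245}⌋` (`Shute2021.mainCount_sub_linear_le_of_truncated'`, the variant of
  `mainCount_sub_linear_le_of_truncated` requiring the truncated asymptotic only for
  `D ≤ B^{4/245}`) gives Theorem 1.1.

## References

* A. Shute, *Sums of four squareful numbers*, arXiv:2104.06966v1 [math.NT] (2021), Theorem 1.1,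
  Theorem 4.2, Lemma 4.15, §5: (5.1), (5.5)–(5.7), Lemmas 5.3–5.5, (5.9), (5.10) and the last
  paragraph before §5.1. [Shute2021]
-/

noncomputable section

open Finset

namespace Literature.NumberTheory.DiophantineGeometry

namespace Shute2021


/-! ### The last paragraph of §5 with the `D`-range actually available -/

/-- Variant of `mainCount_sub_linear_le_of_truncated` in which the truncated asymptotic is only
required for `D ≤ B^{4/245}` (the proof of that theorem uses it at `D = ⌊B^{4/245}⌋` only; Theorem
4.2 does not reach `D ≤ B^{1/16}`, see the module docstring, erratum on the `s₀`-sum).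
[cite: Shute2021, §5, last paragraph before §5.1] -/
theorem mainCount_sub_linear_le_of_truncated' (h31 : Shute2021_prop31) {c : ℝ}
    (hmain : ∀ ε : ℝ, 0 < ε → ∃ C : ℝ, ∀ B D : ℕ, 1 ≤ B → 1 ≤ D →
      (D : ℝ) ≤ (B : ℝ) ^ (4 / 245 : ℝ) →
        |(mainCountTrunc B D : ℝ) - c * B| ≤
          C * ((B : ℝ) ^ (1 + ε) * (D : ℝ) ^ (-(1 / 4 : ℝ)) +
            (B : ℝ) ^ (41 / 42 + ε : ℝ) * (D : ℝ) ^ (11 / 8 : ℝ))) :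
    ∀ ε : ℝ, 0 < ε → ∃ C : ℝ, ∀ B : ℕ, 1 ≤ B →
      |(mainCount B : ℝ) - c * B| ≤ C * (B : ℝ) ^ (734 / 735 + ε : ℝ) := by
  intro ε hε
  obtain ⟨C₁, hC₁, h51⟩ := Shute2021_prop31.mainCount_le h31 ε hε
  obtain ⟨C₂, h2⟩ := hmain ε hε
  set C₂' := max C₂ 0 with hC₂'
  refine ⟨C₂' * ((2 : ℝ) ^ (1 / 4 : ℝ) + 1) + C₁ * (2 : ℝ) ^ (1 / 12 : ℝ), fun B hB => ?_⟩
  have hB1 : (1 : ℝ) ≤ B := by exact_mod_cast hB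
  have hB0 : (0 : ℝ) < B := by linarith
  set t : ℝ := (B : ℝ) ^ (4 / 245 : ℝ) with ht
  have ht1 : 1 ≤ t := Real.one_le_rpow hB1 (by norm_num)
  set D : ℕ := ⌊t⌋₊ with hD
  obtain ⟨hD1, hDt, htD⟩ := one_le_floor_and ht1
  have hD0 : (0 : ℝ) < D := by exact_mod_cast hD1
  have hlow : (mainCountTrunc B D : ℝ) ≤ mainCount B := by exact_mod_cast mainCountTrunc_le B D
  have hupp := h51 B D hB hD1
  have hmid := h2 B D hB hD1 hDt
  have e1 : (D : ℝ) ^ (-(1 / 12 : ℝ)) ≤ (2 : ℝ) ^ (1 / 12 : ℝ) * (B : ℝ) ^ (-(1 / 735 : ℝ)) := by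
    have := floor_rpow_neg_le ht1 (by norm_num : (0 : ℝ) ≤ 1 / 12)
    rw [← hD] at this
    refine this.trans (le_of_eq ?_)
    rw [ht, ← Real.rpow_mul hB0.le]
    norm_num
  have e2 : (D : ℝ) ^ (-(1 / 4 : ℝ)) ≤ (2 : ℝ) ^ (1 / 4 : ℝ) * (B : ℝ) ^ (-(1 / 245 : ℝ)) := by
    have := floor_rpow_neg_le ht1 (by norm_num : (0 : ℝ) ≤ 1 / 4)
    rw [← hD] at this
    refine this.trans (le_of_eq ?_)
    rw [ht, ← Real.rpow_mul hB0.le]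
    norm_num
  have e3 : (D : ℝ) ^ (11 / 8 : ℝ) ≤ (B : ℝ) ^ (11 / 490 : ℝ) := by
    have := floor_rpow_le ht1 (by norm_num : (0 : ℝ) ≤ 11 / 8)
    rw [← hD] at this
    refine this.trans (le_of_eq ?_)
    rw [ht, ← Real.rpow_mul hB0.le]
    norm_num
  set M : ℝ := (B : ℝ) ^ (734 / 735 + ε : ℝ) with hM
  have hM0 : 0 < M := Real.rpow_pos_of_pos hB0 _
  have p1 : (B : ℝ) ^ (1 + ε) * (D : ℝ) ^ (-(1 / 12 : ℝ)) ≤ (2 : ℝ) ^ (1 / 12 : ℝ) * M := by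
    calc (B : ℝ) ^ (1 + ε) * (D : ℝ) ^ (-(1 / 12 : ℝ))
        ≤ (B : ℝ) ^ (1 + ε) * ((2 : ℝ) ^ (1 / 12 : ℝ) * (B : ℝ) ^ (-(1 / 735 : ℝ))) :=
          mul_le_mul_of_nonneg_left e1 (by positivity)
      _ = (2 : ℝ) ^ (1 / 12 : ℝ) * ((B : ℝ) ^ (1 + ε) * (B : ℝ) ^ (-(1 / 735 : ℝ))) := by ring
      _ = (2 : ℝ) ^ (1 / 12 : ℝ) * M := by
          rw [← Real.rpow_add hB0, hM]; norm_num; ring_nf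
  have p2 : (B : ℝ) ^ (1 + ε) * (D : ℝ) ^ (-(1 / 4 : ℝ)) ≤ (2 : ℝ) ^ (1 / 4 : ℝ) * M := by
    calc (B : ℝ) ^ (1 + ε) * (D : ℝ) ^ (-(1 / 4 : ℝ))
        ≤ (B : ℝ) ^ (1 + ε) * ((2 : ℝ) ^ (1 / 4 : ℝ) * (B : ℝ) ^ (-(1 / 245 : ℝ))) :=
          mul_le_mul_of_nonneg_left e2 (by positivity)
      _ = (2 : ℝ) ^ (1 / 4 : ℝ) * ((B : ℝ) ^ (1 + ε) * (B : ℝ) ^ (-(1 / 245 : ℝ))) := by ring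
      _ = (2 : ℝ) ^ (1 / 4 : ℝ) * (B : ℝ) ^ (1 + ε + -(1 / 245 : ℝ)) := by
          rw [← Real.rpow_add hB0]
      _ ≤ (2 : ℝ) ^ (1 / 4 : ℝ) * M := by
          refine mul_le_mul_of_nonneg_left ?_ (by positivity)
          exact Real.rpow_le_rpow_of_exponent_le hB1 (by norm_num; linarith)
  have p3 : (B : ℝ) ^ (41 / 42 + ε : ℝ) * (D : ℝ) ^ (11 / 8 : ℝ) ≤ M := by
    calc (B : ℝ) ^ (41 / 42 + ε : ℝ) * (D : ℝ) ^ (11 / 8 : ℝ)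
        ≤ (B : ℝ) ^ (41 / 42 + ε : ℝ) * (B : ℝ) ^ (11 / 490 : ℝ) :=
          mul_le_mul_of_nonneg_left e3 (by positivity)
      _ = M := by rw [← Real.rpow_add hB0, hM]; norm_num; ring_nf
  have hmid' : |(mainCountTrunc B D : ℝ) - c * B| ≤ C₂' * (((2 : ℝ) ^ (1 / 4 : ℝ) + 1) * M) := by
    refine hmid.trans ?_
    have hsum : (B : ℝ) ^ (1 + ε) * (D : ℝ) ^ (-(1 / 4 : ℝ)) +
        (B : ℝ) ^ (41 / 42 + ε : ℝ) * (D : ℝ) ^ (11 / 8 : ℝ) ≤ ((2 : ℝ) ^ (1 / 4 : ℝ) + 1) * M := by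
      nlinarith [p2, p3]
    have hnn : 0 ≤ (B : ℝ) ^ (1 + ε) * (D : ℝ) ^ (-(1 / 4 : ℝ)) +
        (B : ℝ) ^ (41 / 42 + ε : ℝ) * (D : ℝ) ^ (11 / 8 : ℝ) := by positivity
    calc C₂ * ((B : ℝ) ^ (1 + ε) * (D : ℝ) ^ (-(1 / 4 : ℝ)) +
          (B : ℝ) ^ (41 / 42 + ε : ℝ) * (D : ℝ) ^ (11 / 8 : ℝ))
        ≤ C₂' * ((B : ℝ) ^ (1 + ε) * (D : ℝ) ^ (-(1 / 4 : ℝ)) +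
          (B : ℝ) ^ (41 / 42 + ε : ℝ) * (D : ℝ) ^ (11 / 8 : ℝ)) :=
          mul_le_mul_of_nonneg_right (le_max_left _ _) hnn
      _ ≤ C₂' * (((2 : ℝ) ^ (1 / 4 : ℝ) + 1) * M) :=
          mul_le_mul_of_nonneg_left hsum (le_max_right _ _)
  have hupp' : (mainCount B : ℝ) - mainCountTrunc B D ≤ C₁ * ((2 : ℝ) ^ (1 / 12 : ℝ) * M) := by
    have : C₁ * (B : ℝ) ^ (1 + ε) * (D : ℝ) ^ (-(1 / 12 : ℝ)) ≤ C₁ * ((2 : ℝ) ^ (1 / 12 : ℝ) * M) := by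
      rw [mul_assoc]; exact mul_le_mul_of_nonneg_left p1 hC₁.le
    linarith
  rw [abs_le] at hmid' ⊢
  constructor <;> nlinarith [hmid'.1, hmid'.2, hlow, hupp', hM0, le_max_right C₂ 0, hC₁]

/-! ### Where Theorem 4.2 applies: `1 ≤ B′` and `|A′| ≤ B′^{4/7}` -/

/-- For `B ≥ 128`, `1 ≤ D ≤ B^{4/245}`, `d₀ ≤ B^{1/4}D` and `|A′| ≤ D¹¹`: the height
`B′ = ⌊B/d₀²⌋` satisfies `B′ ≥ 1` and `|A′| ≤ B′^{4/7}` (numerics: `⌊t⌋ ≥ t/2` for `t ≥ 1`,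
`2 D^{85/4} ≤ 2 B^{17/49} ≤ B^{1/2}` as soon as `B^{15/98} ≥ 2`). The paper applies Theorem 4.2 for
all `D ≤ B^{1/16}`, which the condition `|S²Y³| ≤ (B/s₀²)^{4/7}` does not allow; `D ≤ B^{4/245}` is
what the final choice of `D` needs. [cite: Shute2021, §5, (5.7)] -/
theorem applicability {B D d₀ : ℕ} {A : ℝ} (hB : 128 ≤ B) (hD : 1 ≤ D)
    (hDB : (D : ℝ) ≤ (B : ℝ) ^ (4 / 245 : ℝ)) (hd0 : 1 ≤ d₀)
    (hd : (d₀ : ℝ) ≤ (B : ℝ) ^ (1 / 4 : ℝ) * D) (hA : A ≤ (D : ℝ) ^ 11) :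
    1 ≤ B / d₀ ^ 2 ∧ A ≤ ((B / d₀ ^ 2 : ℕ) : ℝ) ^ (4 / 7 : ℝ) := by
  have hB1 : (1 : ℝ) ≤ B := by exact_mod_cast (le_trans (by norm_num) hB)
  have hB0 : (0 : ℝ) < B := by linarith
  have hD1 : (1 : ℝ) ≤ D := by exact_mod_cast hD
  have hD0 : (0 : ℝ) < D := by linarith
  have hd1 : (1 : ℝ) ≤ d₀ := by exact_mod_cast hd0
  have hd00 : (0 : ℝ) < d₀ := by linarith
  -- `t = B / d₀² ≥ B^{1/2} / D² ≥ 1`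
  set t : ℝ := (B : ℝ) / (d₀ : ℝ) ^ 2 with ht
  have hS : (d₀ : ℝ) ^ 2 ≤ (B : ℝ) ^ (1 / 2 : ℝ) * (D : ℝ) ^ 2 := by
    calc (d₀ : ℝ) ^ 2 ≤ ((B : ℝ) ^ (1 / 4 : ℝ) * D) ^ 2 := by gcongr
      _ = (B : ℝ) ^ (1 / 2 : ℝ) * (D : ℝ) ^ 2 := by
          rw [mul_pow, ← Real.rpow_natCast ((B : ℝ) ^ (1 / 4 : ℝ)) 2, ← Real.rpow_mul hB0.le]
          norm_num
  have hD2 : (D : ℝ) ^ 2 ≤ (B : ℝ) ^ (8 / 245 : ℝ) := by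
    calc (D : ℝ) ^ 2 ≤ ((B : ℝ) ^ (4 / 245 : ℝ)) ^ 2 := by gcongr
      _ = (B : ℝ) ^ (8 / 245 : ℝ) := by
          rw [← Real.rpow_natCast ((B : ℝ) ^ (4 / 245 : ℝ)) 2, ← Real.rpow_mul hB0.le]; norm_num
  have ht_low : (B : ℝ) ^ (1 / 2 : ℝ) / (D : ℝ) ^ 2 ≤ t := by
    rw [ht, div_le_div_iff₀ (by positivity) (by positivity)]
    calc (B : ℝ) ^ (1 / 2 : ℝ) * (d₀ : ℝ) ^ 2 ≤ (B : ℝ) ^ (1 / 2 : ℝ) * ((B : ℝ) ^ (1 / 2 : ℝ) * (D : ℝ) ^ 2) :=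
          mul_le_mul_of_nonneg_left hS (by positivity)
      _ = (B : ℝ) * (D : ℝ) ^ 2 := by
          rw [← mul_assoc, ← Real.rpow_add hB0]; norm_num
  have ht1 : 1 ≤ t := by
    refine le_trans ?_ ht_low
    rw [le_div_iff₀ (by positivity), one_mul]
    calc (D : ℝ) ^ 2 ≤ (B : ℝ) ^ (8 / 245 : ℝ) := hD2
      _ ≤ (B : ℝ) ^ (1 / 2 : ℝ) := Real.rpow_le_rpow_of_exponent_le hB1 (by norm_num)
  -- `B' = ⌊t⌋`
  have hfloor : ((B / d₀ ^ 2 : ℕ) : ℝ) = ⌊t⌋₊ := by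
    rw [ht, ← Nat.floor_div_eq_div (K := ℝ)]; push_cast; rfl
  obtain ⟨hf1, -, hf3⟩ := one_le_floor_and ht1
  constructor
  · have : (1 : ℝ) ≤ ((B / d₀ ^ 2 : ℕ) : ℝ) := by rw [hfloor]; exact_mod_cast hf1
    exact_mod_cast this
  -- `A ≤ D^{11} ≤ (t/2)^{4/7} ≤ ⌊t⌋^{4/7}`
  have hkey : (D : ℝ) ^ 11 ≤ (t / 2) ^ (4 / 7 : ℝ) := by
    -- `D^{11} = (D^{77/4})^{4/7}` and `D^{77/4} ≤ t/2 ⟸ 2 D^{85/4} ≤ B^{1/2}`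
    have e : (D : ℝ) ^ 11 = ((D : ℝ) ^ (77 / 4 : ℝ)) ^ (4 / 7 : ℝ) := by
      rw [← Real.rpow_mul hD0.le]
      norm_num
    rw [e]
    refine Real.rpow_le_rpow (by positivity) ?_ (by norm_num)
    rw [le_div_iff₀ (by norm_num : (0 : ℝ) < 2)]
    refine le_trans ?_ ht_low
    rw [le_div_iff₀ (by positivity)]
    -- `D^{77/4} · 2 · D² = 2 D^{85/4} ≤ 2 B^{17/49} ≤ B^{15/98} B^{17/49} = B^{1/2}`
    have h85 : (D : ℝ) ^ (77 / 4 : ℝ) * 2 * (D : ℝ) ^ 2 = 2 * (D : ℝ) ^ (85 / 4 : ℝ) := by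
      rw [show (D : ℝ) ^ 2 = (D : ℝ) ^ ((2 : ℕ) : ℝ) from (Real.rpow_natCast _ 2).symm,
        mul_assoc, mul_comm _ ((D : ℝ) ^ ((2 : ℕ) : ℝ)), ← mul_assoc, ← Real.rpow_add hD0]
      norm_num; ring
    rw [h85]
    have h1749 : (D : ℝ) ^ (85 / 4 : ℝ) ≤ (B : ℝ) ^ (17 / 49 : ℝ) := by
      calc (D : ℝ) ^ (85 / 4 : ℝ) ≤ ((B : ℝ) ^ (4 / 245 : ℝ)) ^ (85 / 4 : ℝ) :=
            Real.rpow_le_rpow hD0.le hDB (by norm_num)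
        _ = (B : ℝ) ^ (17 / 49 : ℝ) := by rw [← Real.rpow_mul hB0.le]; norm_num
    have h2 : (2 : ℝ) ≤ (B : ℝ) ^ (15 / 98 : ℝ) := by
      have h128 : (128 : ℝ) ≤ B := by exact_mod_cast hB
      calc (2 : ℝ) ≤ (128 : ℝ) ^ (15 / 98 : ℝ) := by
            rw [show (128 : ℝ) = 2 ^ (7 : ℝ) by norm_num, ← Real.rpow_mul (by norm_num)]
            refine le_trans (by norm_num : (2 : ℝ) ≤ 2 ^ (1 : ℝ)) ?_
            exact Real.rpow_le_rpow_of_exponent_le (by norm_num) (by norm_num)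
        _ ≤ (B : ℝ) ^ (15 / 98 : ℝ) := Real.rpow_le_rpow (by norm_num) h128 (by norm_num)
    calc 2 * (D : ℝ) ^ (85 / 4 : ℝ) ≤ (B : ℝ) ^ (15 / 98 : ℝ) * (B : ℝ) ^ (17 / 49 : ℝ) :=
          mul_le_mul h2 h1749 (by positivity) (by positivity)
      _ = (B : ℝ) ^ (1 / 2 : ℝ) := by rw [← Real.rpow_add hB0]; norm_num
  calc A ≤ (D : ℝ) ^ 11 := hA
    _ ≤ (t / 2) ^ (4 / 7 : ℝ) := hkey
    _ ≤ ((B / d₀ ^ 2 : ℕ) : ℝ) ^ (4 / 7 : ℝ) := by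
        rw [hfloor]
        exact Real.rpow_le_rpow (by positivity) hf3 (by norm_num)

/-! ### Theorem 4.2 at one admissible `(d, 𝐲)` -/

/-- `0 ≤ B/k − ⌊B/k⌋ ≤ 1` for the natural-number division, as reals. [folklore] -/
theorem natDiv_sub_le (B k : ℕ) :
    |(((B / k : ℕ) : ℕ) : ℝ) - (B : ℝ) / k| ≤ 1 := by
  have h1 : (((B / k : ℕ) : ℕ) : ℝ) ≤ (B : ℝ) / k := Nat.cast_div_le
  have h2 : (B : ℝ) / k < (((B / k : ℕ) : ℕ) : ℝ) + 1 := by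
    rw [← Nat.floor_div_eq_div (K := ℝ)]
    exact Nat.lt_floor_add_one _
  rw [abs_le]; constructor <;> linarith

/-- **Theorem 4.2 applied at `(𝐚′(d,𝐲), B′ = ⌊B/d₀²⌋)`** and compared with the `(d, 𝐲)`-term of the
constant: if `B′ ≥ 1` and `|A′| ≤ B′^{4/7}` then
`|μ(d) N⁺_{𝐬(d,𝐲)²𝐲³}(B) − (B/16) cTerm(d,𝐲)| ≤ (C₂/16)(B/d₀²)^{41/42+ε} + C₁/16`
(`N⁺_{𝐬²𝐲³}(B) = N_{𝐚′}(B′)/16`; the error term of Theorem 4.2 with `Δ^{1/3} ≤ |A′|^{11/24}`; and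
`|B′ − B/d₀²| ≤ 1` against `|𝔠(𝐚′)| ≤ C₁|A′|^{ε₁}Δ^{1/4} ≤ C₁|A′|^{1/2}`).
[cite: Shute2021, §5, (5.7)] -/
theorem local_estimate {𝔠 : (Fin 4 → ℤ) → ℝ} {ε' ε₁ C₁ C₂ : ℝ} (hε' : 0 < ε') (hε₁ : 0 < ε₁)
    (hε₁4 : ε₁ ≤ 1 / 4)
    (hC₁ : ∀ a : Fin 4 → ℤ, (∀ i, a i ≠ 0) → ¬ IsSquare (∏ i, a i) →
      |𝔠 a| ≤ C₁ * ((|∏ i, a i| : ℤ) : ℝ) ^ ε₁ * (delta a : ℝ) ^ (1 / 4 : ℝ))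
    (hC₂ : ∀ (a : Fin 4 → ℤ) (B : ℕ), 1 ≤ B → (∀ i, a i ≠ 0) → ¬ IsSquare (∏ i, a i) →
      ((|∏ i, a i| : ℤ) : ℝ) ≤ (B : ℝ) ^ (4 / 7 : ℝ) →
      |(quadCount a B : ℝ) - 𝔠 a * B / ((|∏ i, a i| : ℤ) : ℝ) ^ (1 / 2 : ℝ)| ≤
        C₂ * (B : ℝ) ^ (41 / 42 + ε' : ℝ) * (delta a : ℝ) ^ (1 / 3 : ℝ) /
          ((|∏ i, a i| : ℤ) : ℝ) ^ (11 / 24 : ℝ))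
    {d : ℕ} {y : Fin 4 → ℤ} (hadm : Adm (d, y)) (B : ℕ) (hB' : 1 ≤ B / dFree d y ^ 2)
    (happ : ((|∏ i, coeffVec d y i| : ℤ) : ℝ) ≤ ((B / dFree d y ^ 2 : ℕ) : ℝ) ^ (4 / 7 : ℝ)) :
    |(ArithmeticFunction.moebius d : ℝ) *
          (posQuadCount (fun i => (sVec d y i : ℤ) ^ 2 * y i ^ 3) B : ℝ) -
        (B : ℝ) / 16 * cTerm 𝔠 (d, y)| ≤
      max C₂ 0 / 16 * ((B : ℝ) / (dFree d y : ℝ) ^ 2) ^ (41 / 42 + ε' : ℝ) + max C₁ 0 / 16 := by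
  obtain ⟨hd, hy, hsq⟩ := hadm
  have hy0 : ∀ i, y i ≠ 0 := fun i => (hy i).1
  have hd0n : 0 < dFree d y := (dFree_pos_and hd y).1
  have hd0 : (0 : ℝ) < dFree d y := by exact_mod_cast hd0n
  have ha' : ∀ i, coeffVec d y i ≠ 0 := coeffVec_ne_zero hd hy0
  have ha'sq : ¬ IsSquare (∏ i, coeffVec d y i) := by rwa [isSquare_prod_coeffVec_iff hd hy0]
  set A : ℝ := ((|∏ i, coeffVec d y i| : ℤ) : ℝ) with hA
  have hA1 : 1 ≤ A := by
    have : (∏ i, coeffVec d y i) ≠ 0 := prod_ne_zero_iff.2 fun i _ => ha' i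
    rw [hA]; exact_mod_cast Int.one_le_abs this
  have hA0 : 0 < A := by linarith
  set B' : ℕ := B / dFree d y ^ 2 with hB'def
  -- the count: `N⁺_{𝐬²𝐲³}(B) = N_{𝐚′}(B′) / 16`
  have hN : posQuadCount (fun i => (sVec d y i : ℤ) ^ 2 * y i ^ 3) B =
      posQuadCount (coeffVec d y) B' := posQuadCount_sVec_eq hd hy0 B
  have hq : (posQuadCount (fun i => (sVec d y i : ℤ) ^ 2 * y i ^ 3) B : ℝ) =
      (quadCount (coeffVec d y) B' : ℝ) / 16 := by
    rw [hN, quadCount_eq_sixteen_mul]; push_cast; ring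
  -- the term
  have hT : cTerm 𝔠 (d, y) = (ArithmeticFunction.moebius d : ℝ) * 𝔠 (coeffVec d y) /
      ((dFree d y : ℝ) ^ 2 * A ^ (1 / 2 : ℝ)) := by
    unfold cTerm; rw [if_pos ⟨hd, hy, hsq⟩]
  have hR : 0 < A ^ (1 / 2 : ℝ) := Real.rpow_pos_of_pos hA0 _
  -- the two inputs
  have h2 := hC₂ (coeffVec d y) B' hB' ha' ha'sq happ
  have h1 := hC₁ (coeffVec d y) ha' ha'sq
  have hmu : |(ArithmeticFunction.moebius d : ℝ)| ≤ 1 := by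
    exact_mod_cast ArithmeticFunction.abs_moebius_le_one (n := d)
  -- algebraic splitting
  set μr : ℝ := (ArithmeticFunction.moebius d : ℝ) with hμr
  set q : ℝ := (quadCount (coeffVec d y) B' : ℝ) with hqdef
  set m : ℝ := 𝔠 (coeffVec d y) with hm
  set R : ℝ := A ^ (1 / 2 : ℝ) with hRdef
  set dd : ℝ := (dFree d y : ℝ) ^ 2 with hdd
  have hdd0 : 0 < dd := by positivity
  have hsplit : μr * (q / 16) - (B : ℝ) / 16 * (μr * m / (dd * R)) =
      μr / 16 * (q - m * B' / R) + μr * m / (16 * R) * ((B' : ℝ) - (B : ℝ) / dd) := by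
    field_simp
    ring
  rw [hq, hT, hsplit]
  -- first piece: the error term of Theorem 4.2
  have hΔA : (delta (coeffVec d y) : ℝ) ^ (1 / 3 : ℝ) / A ^ (11 / 24 : ℝ) ≤ 1 := by
    rw [div_le_one (Real.rpow_pos_of_pos hA0 _)]
    have hΔ : (delta (coeffVec d y) : ℝ) ≤ A := by
      have h' : ((delta (coeffVec d y) : ℕ) : ℤ) ≤ |∏ i, coeffVec d y i| := by
        rw [← Int.natCast_natAbs]; exact_mod_cast delta_le_natAbs_prod ha'
      rw [hA]; exact_mod_cast h'
    calc (delta (coeffVec d y) : ℝ) ^ (1 / 3 : ℝ) ≤ A ^ (1 / 3 : ℝ) :=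
          Real.rpow_le_rpow (Nat.cast_nonneg _) hΔ (by norm_num)
      _ ≤ A ^ (11 / 24 : ℝ) := Real.rpow_le_rpow_of_exponent_le hA1 (by norm_num)
  have hB'le : (B' : ℝ) ≤ (B : ℝ) / dd := by
    rw [hdd, hB'def, ← Nat.cast_pow]; exact Nat.cast_div_le
  have hfirst : |μr / 16 * (q - m * B' / R)| ≤
      max C₂ 0 / 16 * ((B : ℝ) / dd) ^ (41 / 42 + ε' : ℝ) := by
    rw [abs_mul, abs_div, abs_of_pos (by norm_num : (0 : ℝ) < 16)]
    have hq' : |q - m * B' / R| ≤ max C₂ 0 * (B' : ℝ) ^ (41 / 42 + ε' : ℝ) := by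
      refine h2.trans ?_
      calc C₂ * (B' : ℝ) ^ (41 / 42 + ε' : ℝ) * (delta (coeffVec d y) : ℝ) ^ (1 / 3 : ℝ) /
              A ^ (11 / 24 : ℝ)
          = C₂ * ((B' : ℝ) ^ (41 / 42 + ε' : ℝ) *
              ((delta (coeffVec d y) : ℝ) ^ (1 / 3 : ℝ) / A ^ (11 / 24 : ℝ))) := by ring
        _ ≤ max C₂ 0 * ((B' : ℝ) ^ (41 / 42 + ε' : ℝ) *
              ((delta (coeffVec d y) : ℝ) ^ (1 / 3 : ℝ) / A ^ (11 / 24 : ℝ))) :=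
            mul_le_mul_of_nonneg_right (le_max_left _ _) (by positivity)
        _ ≤ max C₂ 0 * ((B' : ℝ) ^ (41 / 42 + ε' : ℝ) * 1) := by gcongr
        _ = max C₂ 0 * (B' : ℝ) ^ (41 / 42 + ε' : ℝ) := by ring
    have hpow : (B' : ℝ) ^ (41 / 42 + ε' : ℝ) ≤ ((B : ℝ) / dd) ^ (41 / 42 + ε' : ℝ) :=
      Real.rpow_le_rpow (Nat.cast_nonneg _) hB'le (by linarith)
    calc |μr| / 16 * |q - m * B' / R| ≤ 1 / 16 * (max C₂ 0 * (B' : ℝ) ^ (41 / 42 + ε' : ℝ)) := by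
          gcongr
      _ ≤ 1 / 16 * (max C₂ 0 * ((B : ℝ) / dd) ^ (41 / 42 + ε' : ℝ)) := by
          gcongr
      _ = max C₂ 0 / 16 * ((B : ℝ) / dd) ^ (41 / 42 + ε' : ℝ) := by ring
  -- second piece: `|B′ − B/d₀²| ≤ 1` against `|𝔠(𝐚′)| ≤ C₁ |A′|^{ε₁} Δ^{1/4} ≤ max(C₁,0) |A′|^{1/2}`
  have hsecond : |μr * m / (16 * R) * ((B' : ℝ) - (B : ℝ) / dd)| ≤ max C₁ 0 / 16 := by
    rw [abs_mul]
    have hfl : |(B' : ℝ) - (B : ℝ) / dd| ≤ 1 := by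
      rw [hdd, hB'def]
      have := natDiv_sub_le B (dFree d y ^ 2)
      push_cast at this ⊢
      exact this
    have hm' : |m| ≤ max C₁ 0 * R := by
      refine h1.trans ?_
      have hΔ4 : (delta (coeffVec d y) : ℝ) ^ (1 / 4 : ℝ) ≤ A ^ (1 / 4 : ℝ) := by
        refine Real.rpow_le_rpow (Nat.cast_nonneg _) ?_ (by norm_num)
        rw [hA, ← Int.cast_natCast]
        exact_mod_cast (show ((delta (coeffVec d y) : ℕ) : ℤ) ≤ |∏ i, coeffVec d y i| from by
          rw [← Int.natCast_natAbs]; exact_mod_cast delta_le_natAbs_prod ha')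
      calc C₁ * A ^ ε₁ * (delta (coeffVec d y) : ℝ) ^ (1 / 4 : ℝ)
          ≤ max C₁ 0 * A ^ ε₁ * (delta (coeffVec d y) : ℝ) ^ (1 / 4 : ℝ) := by
            gcongr; exact le_max_left _ _
        _ ≤ max C₁ 0 * A ^ ε₁ * A ^ (1 / 4 : ℝ) := by gcongr
        _ = max C₁ 0 * A ^ (ε₁ + 1 / 4) := by rw [mul_assoc, ← Real.rpow_add hA0]
        _ ≤ max C₁ 0 * A ^ (1 / 2 : ℝ) := by
            refine mul_le_mul_of_nonneg_left ?_ (le_max_right _ _)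
            exact Real.rpow_le_rpow_of_exponent_le hA1 (by linarith)
    calc |μr * m / (16 * R)| * |(B' : ℝ) - (B : ℝ) / dd| ≤ |μr * m / (16 * R)| * 1 :=
          mul_le_mul_of_nonneg_left hfl (abs_nonneg _)
      _ = |μr| * |m| / (16 * R) := by
          rw [mul_one, abs_div, abs_mul, abs_of_pos (by positivity : (0 : ℝ) < 16 * R)]
      _ ≤ 1 * (max C₁ 0 * R) / (16 * R) := by gcongr
      _ = max C₁ 0 / 16 := by field_simp
  calc |μr / 16 * (q - m * B' / R) + μr * m / (16 * R) * ((B' : ℝ) - (B : ℝ) / dd)|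
      ≤ |μr / 16 * (q - m * B' / R)| + |μr * m / (16 * R) * ((B' : ℝ) - (B : ℝ) / dd)| :=
        abs_add_le _ _
    _ ≤ max C₂ 0 / 16 * ((B : ℝ) / dd) ^ (41 / 42 + ε' : ℝ) + max C₁ 0 / 16 :=
        add_le_add hfirst hsecond

/-! ### Sums over the index set `𝒟 × 𝒴` of `N(D, B)` -/

/-- The `d`-range of `mainCountTrunc_eq_sum_moebius_posQuadCount`. [folklore] -/
def dRange (B : ℕ) : Finset ℕ := (Icc 1 B).filter Squarefree

/-- Members of `yVectors B D`: nonzero square-free coordinates, `Y ≠ □`, `|Y| ≤ D`. [folklore] -/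
theorem mem_yVectors_iff {B D : ℕ} {y : Fin 4 → ℤ} : y ∈ yVectors B D ↔
    y ∈ box (fun _ => B) ∧ (∀ i, y i ≠ 0 ∧ Squarefree (y i).natAbs) ∧ ¬ IsSquare (∏ i, y i) ∧
      |∏ i, y i| ≤ (D : ℤ) := by
  unfold yVectors
  rw [mem_filter]

/-- For `y ∈ yVectors B D`: `yᵢ ≠ 0` and `1 ≤ |Y| ≤ D`. [folklore] -/
theorem ne_zero_of_mem_yVectors {B D : ℕ} {y : Fin 4 → ℤ} (hy : y ∈ yVectors B D) :
    (∀ i, y i ≠ 0) ∧ 1 ≤ (∏ i, y i).natAbs ∧ (∏ i, y i).natAbs ≤ D := by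
  rw [mem_yVectors_iff] at hy
  obtain ⟨-, h1, -, h3⟩ := hy
  have h0 : ∀ i, y i ≠ 0 := fun i => (h1 i).1
  have hY : (∏ i, y i) ≠ 0 := prod_ne_zero_iff.2 fun i _ => h0 i
  refine ⟨h0, Nat.one_le_iff_ne_zero.2 (Int.natAbs_ne_zero.2 hY), ?_⟩
  have : ((∏ i, y i).natAbs : ℤ) ≤ D := by rw [Int.natCast_natAbs]; exact h3
  exact_mod_cast this

/-- **Generic sum over `𝒟 × 𝒴` through `d₀`**: if `g ≥ 0` and `Σ_{n ∈ T} g(n) ≤ G` for every finite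
set `T` of values `n = d₀(d, 𝐲)` (`d ∈ 𝒟`, `𝐲 ∈ 𝒴` fixed), then
`Σ_{(d,𝐲) ∈ 𝒟 × 𝒴} g(d₀(d,𝐲)) ≤ G · Σ_{𝐲 ∈ 𝒴} τ(|Y|)`. [folklore] -/
theorem sum_dRange_yVectors_le {B D : ℕ} (g : ℕ → ℝ) (hg : ∀ n, 0 ≤ g n) {G : ℝ}
    (hG : ∀ y ∈ yVectors B D, ∀ T : Finset ℕ,
      (∀ n ∈ T, ∃ d ∈ dRange B, n = dFree d y) → ∑ n ∈ T, g n ≤ G) :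
    ∑ p ∈ dRange B ×ˢ yVectors B D, g (dFree p.1 p.2) ≤
      G * ∑ y ∈ yVectors B D, (#((∏ i, y i).natAbs.divisors) : ℝ) := by
  rw [sum_product_right, mul_sum]
  refine sum_le_sum fun y hy => ?_
  have hy0 := (ne_zero_of_mem_yVectors hy).1
  refine (sum_dFree_le hy0 (dRange B) g hg).trans ?_
  rw [mul_comm]
  refine mul_le_mul_of_nonneg_right (hG y hy _ fun n hn => ?_) (Nat.cast_nonneg _)
  rw [mem_image] at hn
  obtain ⟨d, hd, rfl⟩ := hn
  exact ⟨d, hd, rfl⟩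

/-- `Σ_{𝐲 ∈ 𝒴} τ(|Y|) ≤ C_δ C_𝒴 D^{1+2δ}` (divisor bound and the count of `𝒴`). [folklore] -/
theorem sum_card_divisors_yVectors_le {δ Cd Cy : ℝ} (hδ : 0 < δ)
    (hCd : ∀ n : ℕ, n ≠ 0 → (#n.divisors : ℝ) ≤ Cd * (n : ℝ) ^ δ)
    (hCy : ∀ (s : Finset (Fin 4 → ℤ)) (D : ℕ),
      (∀ y ∈ s, (∀ i, y i ≠ 0) ∧ (∏ i, y i).natAbs ≤ D) → (#s : ℝ) ≤ Cy * (D : ℝ) ^ (1 + δ))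
    (B D : ℕ) :
    ∑ y ∈ yVectors B D, (#((∏ i, y i).natAbs.divisors) : ℝ) ≤ Cd * Cy * (D : ℝ) ^ (1 + 2 * δ) := by
  have hCd0 : 0 ≤ Cd := by
    have := hCd 1 one_ne_zero
    simp at this
    linarith
  have h1 : ∀ y ∈ yVectors B D, (#((∏ i, y i).natAbs.divisors) : ℝ) ≤ Cd * (D : ℝ) ^ δ := by
    intro y hy
    obtain ⟨-, hY1, hYD⟩ := ne_zero_of_mem_yVectors hy
    refine (hCd _ (by omega)).trans ?_
    exact mul_le_mul_of_nonneg_left (Real.rpow_le_rpow (Nat.cast_nonneg _)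
      (by exact_mod_cast hYD) hδ.le) hCd0
  have h2 : (#(yVectors B D) : ℝ) ≤ Cy * (D : ℝ) ^ (1 + δ) :=
    hCy _ D fun y hy => ⟨(ne_zero_of_mem_yVectors hy).1, (ne_zero_of_mem_yVectors hy).2.2⟩
  calc ∑ y ∈ yVectors B D, (#((∏ i, y i).natAbs.divisors) : ℝ)
      ≤ ∑ _y ∈ yVectors B D, Cd * (D : ℝ) ^ δ := sum_le_sum h1
    _ = #(yVectors B D) * (Cd * (D : ℝ) ^ δ) := by rw [sum_const, nsmul_eq_mul]
    _ ≤ Cy * (D : ℝ) ^ (1 + δ) * (Cd * (D : ℝ) ^ δ) :=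
        mul_le_mul_of_nonneg_right h2 (by positivity)
    _ = Cd * Cy * (D : ℝ) ^ (1 + 2 * δ) := by
        rw [show 1 + 2 * δ = (1 + δ) + δ by ring,
          Real.rpow_add' (Nat.cast_nonneg D) (show (1 + δ) + δ ≠ 0 by positivity)]
        ring

/-- **The terms with `d₀ > S₀`** (the `s₀`-tail, cut by the trivial bound): for `κ ∈ [0,1]`,
`Σ_{(d,𝐲) ∈ 𝒟×𝒴, d₀ > S₀} N⁺_{𝐬²𝐲³}(B) ≤ Z · Σ_𝐲 τ(|Y|) · B^{3/2} S₀^{κ−2}` where `Z` bounds the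
tails `Σ_{n > S} n^{-3} ≤ Z S^{κ-2}`. [cite: Shute2021, §5 (the s₀-sum of (5.7), truncated)] -/
theorem sum_tail_posQuadCount_le {κ Z : ℝ}
    (hZ : ∀ (T : Finset ℕ) (S : ℝ), 0 < S →
      ∑ n ∈ T with S < ((n : ℕ) : ℝ), ((n : ℕ) : ℝ) ^ (-((1 + κ) + (2 - κ))) ≤ Z * S ^ (-(2 - κ)))
    (B D : ℕ) (S₀ : ℝ) (hS₀ : 0 < S₀) :
    ∑ p ∈ dRange B ×ˢ yVectors B D with S₀ < (dFree p.1 p.2 : ℝ),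
        (posQuadCount (fun i => (sVec p.1 p.2 i : ℤ) ^ 2 * p.2 i ^ 3) B : ℝ) ≤
      Z * S₀ ^ (-(2 - κ)) * (B : ℝ) ^ (3 / 2 : ℝ) *
        ∑ y ∈ yVectors B D, (#((∏ i, y i).natAbs.divisors) : ℝ) := by
  have hB0 : (0 : ℝ) ≤ B := Nat.cast_nonneg _
  -- termwise: `N⁺ ≤ (B/d₀²)^{3/2} = B^{3/2} d₀^{-3}`
  set g : ℕ → ℝ := fun n => if S₀ < (n : ℝ) then (B : ℝ) ^ (3 / 2 : ℝ) * (n : ℝ) ^ (-(3 : ℝ)) else 0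
    with hg
  have hg0 : ∀ n, 0 ≤ g n := fun n => by
    rw [hg]; dsimp only; split_ifs <;> positivity
  have hterm : ∀ p ∈ (dRange B ×ˢ yVectors B D).filter (fun p => S₀ < (dFree p.1 p.2 : ℝ)),
      (posQuadCount (fun i => (sVec p.1 p.2 i : ℤ) ^ 2 * p.2 i ^ 3) B : ℝ) ≤ g (dFree p.1 p.2) := by
    intro p hp
    rw [mem_filter, mem_product] at hp
    obtain ⟨⟨hd, hy⟩, hS⟩ := hp
    have hdsq : Squarefree p.1 := (mem_filter.1 hd).2
    have hy0 := (ne_zero_of_mem_yVectors hy).1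
    have hd0 : (0 : ℝ) < dFree p.1 p.2 := by exact_mod_cast (dFree_pos_and hdsq p.2).1
    rw [hg]; dsimp only; rw [if_pos hS]
    refine (posQuadCount_sVec_le_rpow hdsq hy0 B).trans (le_of_eq ?_)
    show ((B : ℝ) / (dFree p.1 p.2 : ℝ) ^ 2) ^ (3 / 2 : ℝ) = _
    rw [Real.div_rpow hB0 (by positivity), div_eq_mul_inv, ← Real.rpow_neg (by positivity),
      show ((dFree p.1 p.2 : ℝ) ^ 2) = (dFree p.1 p.2 : ℝ) ^ ((2 : ℕ) : ℝ) from
        (Real.rpow_natCast _ 2).symm, ← Real.rpow_mul hd0.le]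
    norm_num
  refine (sum_le_sum hterm).trans ?_
  rw [sum_filter]
  have hG : ∀ y ∈ yVectors B D, ∀ T : Finset ℕ,
      (∀ n ∈ T, ∃ d ∈ dRange B, n = dFree d y) → ∑ n ∈ T, g n ≤
        Z * S₀ ^ (-(2 - κ)) * (B : ℝ) ^ (3 / 2 : ℝ) := by
    intro y _ T _
    rw [hg, ← sum_filter]
    calc ∑ n ∈ T with S₀ < ((n : ℕ) : ℝ), (B : ℝ) ^ (3 / 2 : ℝ) * ((n : ℕ) : ℝ) ^ (-(3 : ℝ))
        = (B : ℝ) ^ (3 / 2 : ℝ) *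
            ∑ n ∈ T with S₀ < ((n : ℕ) : ℝ), ((n : ℕ) : ℝ) ^ (-((1 + κ) + (2 - κ))) := by
          rw [mul_sum]; refine sum_congr rfl fun n _ => ?_; ring_nf
      _ ≤ (B : ℝ) ^ (3 / 2 : ℝ) * (Z * S₀ ^ (-(2 - κ))) :=
          mul_le_mul_of_nonneg_left (hZ T S₀ hS₀) (by positivity)
      _ = Z * S₀ ^ (-(2 - κ)) * (B : ℝ) ^ (3 / 2 : ℝ) := by ring
  have hsum := sum_dRange_yVectors_le (B := B) (D := D) g hg0 hG
  refine le_trans (le_of_eq ?_) hsum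
  refine sum_congr rfl fun p _ => ?_
  rw [hg]
  dsimp only
  split_ifs <;> rfl

/-- **The error terms of Theorem 4.2 summed over `d₀ ≤ S₀`** (and in fact over all of `𝒟 × 𝒴`):
`Σ (B/d₀²)^{e} ≤ Z_{2e} B^{e} Σ_𝐲 τ(|Y|)` for `e = 41/42 + ε`. [cite: Shute2021, §5, (5.9)] -/
theorem sum_err_le {e Z : ℝ}
    (hZ : ∀ T : Finset ℕ, ∑ n ∈ T, (n : ℝ) ^ (-(2 * e)) ≤ Z) (B D : ℕ) :
    ∑ p ∈ dRange B ×ˢ yVectors B D, ((B : ℝ) / (dFree p.1 p.2 : ℝ) ^ 2) ^ e ≤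
      Z * (B : ℝ) ^ e * ∑ y ∈ yVectors B D, (#((∏ i, y i).natAbs.divisors) : ℝ) := by
  have hB0 : (0 : ℝ) ≤ B := Nat.cast_nonneg _
  set g : ℕ → ℝ := fun n => (B : ℝ) ^ e * (n : ℝ) ^ (-(2 * e)) with hg
  have hg0 : ∀ n, 0 ≤ g n := fun n => by rw [hg]; positivity
  have hterm : ∀ p ∈ dRange B ×ˢ yVectors B D,
      ((B : ℝ) / (dFree p.1 p.2 : ℝ) ^ 2) ^ e = g (dFree p.1 p.2) := by
    intro p hp
    rw [mem_product] at hp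
    have hdsq : Squarefree p.1 := (mem_filter.1 hp.1).2
    have hd0 : (0 : ℝ) < dFree p.1 p.2 := by exact_mod_cast (dFree_pos_and hdsq p.2).1
    rw [hg]; dsimp only
    rw [Real.div_rpow hB0 (by positivity), div_eq_mul_inv, ← Real.rpow_neg (by positivity),
      show ((dFree p.1 p.2 : ℝ) ^ 2) = (dFree p.1 p.2 : ℝ) ^ ((2 : ℕ) : ℝ) from
        (Real.rpow_natCast _ 2).symm, ← Real.rpow_mul hd0.le]
    congr 2; push_cast; ring
  rw [sum_congr rfl hterm]
  have hG : ∀ y ∈ yVectors B D, ∀ T : Finset ℕ,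
      (∀ n ∈ T, ∃ d ∈ dRange B, n = dFree d y) → ∑ n ∈ T, g n ≤ Z * (B : ℝ) ^ e := by
    intro y _ T _
    rw [hg, ← mul_sum, mul_comm]
    exact mul_le_mul_of_nonneg_right (hZ T) (by positivity)
  exact sum_dRange_yVectors_le g hg0 hG

/-- **The number of pairs with `d₀ ≤ S₀`**: `#{(d,𝐲) ∈ 𝒟×𝒴 : d₀ ≤ S₀} ≤ S₀ Σ_𝐲 τ(|Y|)`.
[folklore] -/
theorem card_small_le (B D : ℕ) (S₀ : ℝ) (hS₀ : 0 < S₀) :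
    (#{p ∈ dRange B ×ˢ yVectors B D | (dFree p.1 p.2 : ℝ) ≤ S₀} : ℝ) ≤
      S₀ * ∑ y ∈ yVectors B D, (#((∏ i, y i).natAbs.divisors) : ℝ) := by
  set g : ℕ → ℝ := fun n => if (n : ℝ) ≤ S₀ then 1 else 0 with hg
  have hg0 : ∀ n, 0 ≤ g n := fun n => by rw [hg]; dsimp only; split_ifs <;> norm_num
  have hcard : (#{p ∈ dRange B ×ˢ yVectors B D | (dFree p.1 p.2 : ℝ) ≤ S₀} : ℝ) =
      ∑ p ∈ dRange B ×ˢ yVectors B D, g (dFree p.1 p.2) := by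
    rw [hg, ← sum_filter]; simp
  rw [hcard]
  have hG : ∀ y ∈ yVectors B D, ∀ T : Finset ℕ,
      (∀ n ∈ T, ∃ d ∈ dRange B, n = dFree d y) → ∑ n ∈ T, g n ≤ S₀ := by
    intro y _ T hT
    rw [hg, ← sum_filter]
    simp only [sum_const, nsmul_eq_mul, mul_one]
    -- the `n ∈ T` with `n ≤ S₀` are `≥ 1`, hence at most `⌊S₀⌋` of them
    have hsub : T.filter (fun n : ℕ => ((n : ℕ) : ℝ) ≤ S₀) ⊆ Icc 1 ⌊S₀⌋₊ := by
      intro n hn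
      rw [mem_filter] at hn
      obtain ⟨hnT, hnS⟩ := hn
      obtain ⟨d, hd, rfl⟩ := hT n hnT
      rw [mem_Icc]
      exact ⟨(dFree_pos_and (mem_filter.1 hd).2 y).1, Nat.le_floor hnS⟩
    calc (#(T.filter fun n : ℕ => ((n : ℕ) : ℝ) ≤ S₀) : ℝ) ≤ #(Icc 1 ⌊S₀⌋₊) := by
          exact_mod_cast card_le_card hsub
      _ = ⌊S₀⌋₊ := by simp
      _ ≤ S₀ := Nat.floor_le hS₀.le
  exact sum_dRange_yVectors_le g hg0 hG

/-! ### Assembly: the truncated asymptotic from the circle-method input -/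

/-- `N⁺_{𝐬(d,𝐲)²𝐲³}(B)` as a real function of the pair `(d, 𝐲)`. [folklore] -/
def Npair (B : ℕ) (p : ℕ × (Fin 4 → ℤ)) : ℝ :=
  (posQuadCount (fun i => (sVec p.1 p.2 i : ℤ) ^ 2 * p.2 i ^ 3) B : ℝ)

/-- `μ(d)` as a real function of the pair `(d, 𝐲)`. [folklore] -/
def muPair (p : ℕ × (Fin 4 → ℤ)) : ℝ := (ArithmeticFunction.moebius p.1 : ℝ)

/-- `|μ(d)| ≤ 1`. [folklore] -/
theorem abs_muPair_le (p : ℕ × (Fin 4 → ℤ)) : |muPair p| ≤ 1 := by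
  unfold muPair; exact_mod_cast ArithmeticFunction.abs_moebius_le_one (n := p.1)

/-- `N⁺ ≥ 0`. [folklore] -/
theorem Npair_nonneg (B : ℕ) (p : ℕ × (Fin 4 → ℤ)) : 0 ≤ Npair B p := by
  unfold Npair; positivity

/-- `N(D, B)` as a sum over `𝒟 × 𝒴` (real form of
`mainCountTrunc_eq_sum_moebius_posQuadCount`). [cite: Shute2021, §5, (5.5)–(5.7)] -/
theorem mainCountTrunc_eq_sum_pairs (B D : ℕ) :
    (mainCountTrunc B D : ℝ) = ∑ p ∈ dRange B ×ˢ yVectors B D, muPair p * Npair B p := by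
  have h := congrArg (Int.cast : ℤ → ℝ) (mainCountTrunc_eq_sum_moebius_posQuadCount B D)
  push_cast at h
  rw [h, sum_product]
  refine sum_congr rfl fun d _ => ?_
  rw [mul_sum]
  rfl

/-- Pairs of `𝒟 × 𝒴` are admissible, with `d ≥ 1`, `yᵢ ≠ 0` and `|Y| ≤ D`. [folklore] -/
theorem adm_of_mem_pairs {B D : ℕ} {p : ℕ × (Fin 4 → ℤ)} (hp : p ∈ dRange B ×ˢ yVectors B D) :
    Adm p ∧ 1 ≤ p.1 ∧ (∀ i, p.2 i ≠ 0) ∧ (∏ i, p.2 i).natAbs ≤ D := by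
  rw [mem_product] at hp
  obtain ⟨hd, hy⟩ := hp
  have hd' := mem_filter.1 hd
  rw [mem_Icc] at hd'
  have hy' := mem_yVectors_iff.1 hy
  obtain ⟨hy0, -, hyD⟩ := ne_zero_of_mem_yVectors hy
  exact ⟨⟨hd'.2, hy'.2.1, hy'.2.2.1⟩, hd'.1.1, hy0, hyD⟩

/-- Conversely, for `1 ≤ D ≤ B^{4/245}`, every admissible pair with `|Y| ≤ D` and
`d₀ ≤ S₀ = B^{1/4}D` lies in `𝒟 × 𝒴` (`d = d₀d₁ ≤ S₀ |Y| ≤ B^{1/4}D² ≤ B`, `|yᵢ| ≤ |Y| ≤ D ≤ B`).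
[folklore] -/
theorem mem_pairs_of_adm {B D : ℕ} (hB : 1 ≤ B) (hDB : (D : ℝ) ≤ (B : ℝ) ^ (4 / 245 : ℝ))
    {p : ℕ × (Fin 4 → ℤ)} (hadm : Adm p) (hYD : (∏ i, p.2 i).natAbs ≤ D)
    (hdS : (dFree p.1 p.2 : ℝ) ≤ (B : ℝ) ^ (1 / 4 : ℝ) * D) :
    p ∈ dRange B ×ˢ yVectors B D := by
  have hB1 : (1 : ℝ) ≤ B := by exact_mod_cast hB
  have hB0 : (0 : ℝ) < B := by linarith
  have hDB' : (D : ℝ) ≤ B := hDB.trans (by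
    calc (B : ℝ) ^ (4 / 245 : ℝ) ≤ (B : ℝ) ^ (1 : ℝ) :=
          Real.rpow_le_rpow_of_exponent_le hB1 (by norm_num)
      _ = B := Real.rpow_one _)
  obtain ⟨hdsq, hy, hsq⟩ := hadm
  have hy0 : ∀ i, p.2 i ≠ 0 := fun i => (hy i).1
  rw [mem_product]
  constructor
  · rw [dRange, mem_filter, mem_Icc]
    refine ⟨⟨Nat.one_le_iff_ne_zero.2 hdsq.ne_zero, ?_⟩, hdsq⟩
    have hd1 : (dShared p.1 p.2 : ℝ) ≤ D := by
      have hY0 : 0 < (∏ i, p.2 i).natAbs := Int.natAbs_pos.2 (prod_ne_zero_iff.2 fun i _ => hy0 i)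
      exact_mod_cast (Nat.le_of_dvd hY0 (dShared_dvd p.1 p.2)).trans hYD
    have hprod : (p.1 : ℝ) = (dFree p.1 p.2 : ℝ) * dShared p.1 p.2 := by
      exact_mod_cast (dFree_mul_dShared p.1 p.2).symm
    have hle : (p.1 : ℝ) ≤ B := by
      rw [hprod]
      calc (dFree p.1 p.2 : ℝ) * dShared p.1 p.2 ≤ ((B : ℝ) ^ (1 / 4 : ℝ) * D) * D :=
            mul_le_mul hdS hd1 (Nat.cast_nonneg _) (by positivity)
        _ = (B : ℝ) ^ (1 / 4 : ℝ) * (D : ℝ) ^ 2 := by ring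
        _ ≤ (B : ℝ) ^ (1 / 4 : ℝ) * ((B : ℝ) ^ (4 / 245 : ℝ)) ^ 2 := by gcongr
        _ = (B : ℝ) ^ (1 / 4 + 8 / 245 : ℝ) := by
            rw [← Real.rpow_natCast ((B : ℝ) ^ (4 / 245 : ℝ)) 2, ← Real.rpow_mul hB0.le,
              ← Real.rpow_add hB0]; norm_num
        _ ≤ (B : ℝ) ^ (1 : ℝ) := Real.rpow_le_rpow_of_exponent_le hB1 (by norm_num)
        _ = B := Real.rpow_one _
    exact_mod_cast hle
  · rw [mem_yVectors_iff, mem_box]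
    refine ⟨fun i => ?_, hy, hsq, ?_⟩
    · have hyi : (p.2 i).natAbs ≤ (∏ j, p.2 j).natAbs := by
        rw [show (∏ j, p.2 j).natAbs = ∏ j, (p.2 j).natAbs from map_prod Int.natAbsHom _ univ]
        exact Nat.le_of_dvd (prod_pos fun j _ => Int.natAbs_pos.2 (hy0 j))
          (dvd_prod_of_mem _ (mem_univ i))
      have h' : ((p.2 i).natAbs : ℝ) ≤ B := by
        calc ((p.2 i).natAbs : ℝ) ≤ (∏ j, p.2 j).natAbs := by exact_mod_cast hyi
          _ ≤ D := by exact_mod_cast hYD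
          _ ≤ B := hDB'
      have h'' : ((p.2 i).natAbs : ℤ) ≤ B := by exact_mod_cast h'
      rwa [Int.natCast_natAbs] at h''
    · have : ((∏ i, p.2 i).natAbs : ℤ) ≤ D := by exact_mod_cast hYD
      rwa [Int.natCast_natAbs] at this

/-- **The pairs with `d₀ ≤ S₀`, summed**: Theorem 4.2 term by term (`local_estimate`), then
`Σ (B/d₀²)^{41/42+ε} ≤ Z B^{41/42+ε} Σ_𝐲τ(|Y|)` and `#{d₀ ≤ S₀} ≤ S₀ Σ_𝐲 τ(|Y|)`.
[cite: Shute2021, §5, (5.7), (5.9), Lemma 5.4] -/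
theorem sum_local_le {𝔠 : (Fin 4 → ℤ) → ℝ} {ε' ε₁ C₁ C₂ : ℝ} (hε' : 0 < ε') (hε₁ : 0 < ε₁)
    (hε₁4 : ε₁ ≤ 1 / 4)
    (hC₁ : ∀ a : Fin 4 → ℤ, (∀ i, a i ≠ 0) → ¬ IsSquare (∏ i, a i) →
      |𝔠 a| ≤ C₁ * ((|∏ i, a i| : ℤ) : ℝ) ^ ε₁ * (delta a : ℝ) ^ (1 / 4 : ℝ))
    (hC₂ : ∀ (a : Fin 4 → ℤ) (B : ℕ), 1 ≤ B → (∀ i, a i ≠ 0) → ¬ IsSquare (∏ i, a i) →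
      ((|∏ i, a i| : ℤ) : ℝ) ≤ (B : ℝ) ^ (4 / 7 : ℝ) →
      |(quadCount a B : ℝ) - 𝔠 a * B / ((|∏ i, a i| : ℤ) : ℝ) ^ (1 / 2 : ℝ)| ≤
        C₂ * (B : ℝ) ^ (41 / 42 + ε' : ℝ) * (delta a : ℝ) ^ (1 / 3 : ℝ) /
          ((|∏ i, a i| : ℤ) : ℝ) ^ (11 / 24 : ℝ))
    {Z₄ : ℝ} (hZ₄ : ∀ T : Finset ℕ, ∑ n ∈ T, (n : ℝ) ^ (-(2 * (41 / 42 + ε'))) ≤ Z₄)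
    {B D : ℕ} (hB : 128 ≤ B) (hD : 1 ≤ D) (hDB : (D : ℝ) ≤ (B : ℝ) ^ (4 / 245 : ℝ)) :
    ∑ p ∈ dRange B ×ˢ yVectors B D with (dFree p.1 p.2 : ℝ) ≤ (B : ℝ) ^ (1 / 4 : ℝ) * D,
        |muPair p * Npair B p - (B : ℝ) / 16 * cTerm 𝔠 p| ≤
      max C₂ 0 / 16 * (Z₄ * (B : ℝ) ^ (41 / 42 + ε' : ℝ) *
          ∑ y ∈ yVectors B D, (#((∏ i, y i).natAbs.divisors) : ℝ)) +
        max C₁ 0 / 16 * (((B : ℝ) ^ (1 / 4 : ℝ) * D) *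
          ∑ y ∈ yVectors B D, (#((∏ i, y i).natAbs.divisors) : ℝ)) := by
  have hB0 : (0 : ℝ) < B := by exact_mod_cast lt_of_lt_of_le (by norm_num) hB
  have hD0 : (0 : ℝ) < D := by exact_mod_cast hD
  have hS₀ : 0 < (B : ℝ) ^ (1 / 4 : ℝ) * D := by positivity
  have hloc : ∀ p ∈ (dRange B ×ˢ yVectors B D).filter
      (fun p => (dFree p.1 p.2 : ℝ) ≤ (B : ℝ) ^ (1 / 4 : ℝ) * D),
      |muPair p * Npair B p - (B : ℝ) / 16 * cTerm 𝔠 p| ≤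
        max C₂ 0 / 16 * ((B : ℝ) / (dFree p.1 p.2 : ℝ) ^ 2) ^ (41 / 42 + ε' : ℝ) +
          max C₁ 0 / 16 := by
    intro p hp
    rw [mem_filter] at hp
    obtain ⟨hpW, hpS⟩ := hp
    obtain ⟨hadm, -, hy0, hYD⟩ := adm_of_mem_pairs hpW
    have hd0 : 1 ≤ dFree p.1 p.2 := (dFree_pos_and hadm.1 p.2).1
    have hA : ((|∏ i, coeffVec p.1 p.2 i| : ℤ) : ℝ) ≤ (D : ℝ) ^ 11 := by
      have h := abs_prod_coeffVec_le (d := p.1) hy0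
      have h2 : |∏ i, p.2 i| ≤ (D : ℤ) := by
        rw [← Int.natCast_natAbs]; exact_mod_cast hYD
      have h3 : |∏ i, coeffVec p.1 p.2 i| ≤ (D : ℤ) ^ 11 :=
        h.trans (pow_le_pow_left₀ (abs_nonneg _) h2 11)
      exact_mod_cast h3
    obtain ⟨hB', happ⟩ := applicability hB hD hDB hd0 hpS hA
    exact local_estimate hε' hε₁ hε₁4 hC₁ hC₂ hadm B hB' happ
  refine (sum_le_sum hloc).trans ?_
  rw [sum_add_distrib, ← mul_sum, sum_const, nsmul_eq_mul]
  refine add_le_add ?_ ?_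
  · refine mul_le_mul_of_nonneg_left ?_ (by positivity)
    refine le_trans ?_ (sum_err_le hZ₄ B D)
    exact sum_le_sum_of_subset_of_nonneg (filter_subset _ _) fun p _ _ => by positivity
  · rw [mul_comm (_ : ℝ) (max C₁ 0 / 16)]
    refine mul_le_mul_of_nonneg_left ?_ (by positivity)
    exact card_small_le B D _ hS₀

/-- The pairs with `d₀ > S₀` (tail, real form with `Npair`). [folklore] -/
theorem sum_tail_Npair_le {κ Z : ℝ}
    (hZ : ∀ (T : Finset ℕ) (S : ℝ), 0 < S →
      ∑ n ∈ T with S < ((n : ℕ) : ℝ), ((n : ℕ) : ℝ) ^ (-((1 + κ) + (2 - κ))) ≤ Z * S ^ (-(2 - κ)))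
    (B D : ℕ) (S₀ : ℝ) (hS₀ : 0 < S₀) :
    ∑ p ∈ dRange B ×ˢ yVectors B D with ¬ (dFree p.1 p.2 : ℝ) ≤ S₀, |muPair p * Npair B p| ≤
      Z * S₀ ^ (-(2 - κ)) * (B : ℝ) ^ (3 / 2 : ℝ) *
        ∑ y ∈ yVectors B D, (#((∏ i, y i).natAbs.divisors) : ℝ) := by
  have hfilt : (dRange B ×ˢ yVectors B D).filter (fun p => ¬ (dFree p.1 p.2 : ℝ) ≤ S₀) =
      (dRange B ×ˢ yVectors B D).filter (fun p => S₀ < (dFree p.1 p.2 : ℝ)) :=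
    filter_congr fun p _ => not_le
  rw [hfilt]
  refine le_trans (sum_le_sum fun p _ => ?_) (sum_tail_posQuadCount_le hZ B D S₀ hS₀)
  rw [abs_mul, abs_of_nonneg (Npair_nonneg B p)]
  calc |muPair p| * Npair B p ≤ 1 * Npair B p :=
        mul_le_mul_of_nonneg_right (abs_muPair_le p) (Npair_nonneg B p)
    _ = _ := by rw [one_mul]; rfl

/-! ### Exponent bookkeeping (`1 ≤ D ≤ B^{4/245}`, `0 < ε' ≤ min(ε, 1/100)`) -/

/-- `S₀^{-s} = B^{-s/4} D^{-s}` for `S₀ = B^{1/4} D`. [folklore] -/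
theorem S0_rpow_neg {B D : ℝ} (hB : 0 ≤ B) (hD : 0 ≤ D) (s : ℝ) :
    (B ^ (1 / 4 : ℝ) * D) ^ (-s) = B ^ (-s / 4) * D ^ (-s) := by
  rw [Real.mul_rpow (by positivity) hD, ← Real.rpow_mul hB]
  congr 1; ring_nf

/-- `B^{41/42+ε'} D^{1+2δ} ≤ B^{41/42+ε} D^{11/8}`. [folklore] -/
theorem expo_T1 {b d ε ε' δ : ℝ} (hb : 1 ≤ b) (hd : 1 ≤ d) (hε'ε : ε' ≤ ε) (hδ : δ ≤ 3 / 16) :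
    b ^ (41 / 42 + ε' : ℝ) * d ^ (1 + 2 * δ) ≤ b ^ (41 / 42 + ε : ℝ) * d ^ (11 / 8 : ℝ) :=
  mul_le_mul (Real.rpow_le_rpow_of_exponent_le hb (by linarith))
    (Real.rpow_le_rpow_of_exponent_le hd (by linarith)) (by positivity) (by positivity)

/-- `B^{1/4} D · D^{1+2δ} ≤ B^{41/42+ε} D^{11/8}`. [folklore] -/
theorem expo_T2 {b d ε δ : ℝ} (hb : 1 ≤ b) (hd : 1 ≤ d) (hdb : d ≤ b ^ (4 / 245 : ℝ))
    (hε : 0 < ε) (hδ0 : 0 ≤ δ) (hδ : δ ≤ 1) :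
    b ^ (1 / 4 : ℝ) * d * d ^ (1 + 2 * δ) ≤ b ^ (41 / 42 + ε : ℝ) * d ^ (11 / 8 : ℝ) := by
  have hb0 : 0 < b := by linarith
  have hd0 : 0 < d := by linarith
  have e1 : b ^ (1 / 4 : ℝ) * d * d ^ (1 + 2 * δ) =
      b ^ (1 / 4 : ℝ) * d ^ (5 / 8 + 2 * δ) * d ^ (11 / 8 : ℝ) := by
    have : d * d ^ (1 + 2 * δ) = d ^ (5 / 8 + 2 * δ) * d ^ (11 / 8 : ℝ) := by
      rw [← Real.rpow_add hd0, show d * d ^ (1 + 2 * δ) = d ^ (1 : ℝ) * d ^ (1 + 2 * δ) by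
        rw [Real.rpow_one], ← Real.rpow_add hd0]
      ring_nf
    rw [mul_assoc, this, ← mul_assoc]
  have e2 : d ^ (5 / 8 + 2 * δ) ≤ b ^ (4 / 245 * (5 / 8 + 2 * δ)) := by
    rw [Real.rpow_mul hb0.le]
    exact Real.rpow_le_rpow hd0.le hdb (by positivity)
  have e3 : b ^ (1 / 4 : ℝ) * b ^ (4 / 245 * (5 / 8 + 2 * δ)) ≤ b ^ (41 / 42 + ε : ℝ) := by
    rw [← Real.rpow_add hb0]
    exact Real.rpow_le_rpow_of_exponent_le hb (by nlinarith)
  rw [e1]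
  calc b ^ (1 / 4 : ℝ) * d ^ (5 / 8 + 2 * δ) * d ^ (11 / 8 : ℝ)
      ≤ b ^ (1 / 4 : ℝ) * b ^ (4 / 245 * (5 / 8 + 2 * δ)) * d ^ (11 / 8 : ℝ) := by gcongr
    _ ≤ b ^ (41 / 42 + ε : ℝ) * d ^ (11 / 8 : ℝ) := mul_le_mul_of_nonneg_right e3 (by positivity)

/-- `(B^{1/4}D)^{κ−2} B^{3/2} D^{1+2δ} ≤ B^{1+ε} D^{-1/4}` for `κ ≤ 4ε`, `κ + 2δ ≤ 3/4`. [folklore] -/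
theorem expo_T3 {b d ε κ δ : ℝ} (hb : 1 ≤ b) (hd : 1 ≤ d) (hκ : κ ≤ 4 * ε) (hκδ : κ + 2 * δ ≤ 3 / 4) :
    (b ^ (1 / 4 : ℝ) * d) ^ (-(2 - κ)) * b ^ (3 / 2 : ℝ) * d ^ (1 + 2 * δ) ≤
      b ^ (1 + ε) * d ^ (-(1 / 4 : ℝ)) := by
  have hb0 : 0 < b := by linarith
  have hd0 : 0 < d := by linarith
  rw [S0_rpow_neg hb0.le hd0.le]
  have e1 : b ^ (-(2 - κ) / 4) * d ^ (-(2 - κ)) * b ^ (3 / 2 : ℝ) * d ^ (1 + 2 * δ) =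
      b ^ (1 + κ / 4) * d ^ (-1 + κ + 2 * δ) := by
    rw [show b ^ (1 + κ / 4) = b ^ (-(2 - κ) / 4) * b ^ (3 / 2 : ℝ) by
      rw [← Real.rpow_add hb0]; ring_nf,
      show d ^ (-1 + κ + 2 * δ) = d ^ (-(2 - κ)) * d ^ (1 + 2 * δ) by
      rw [← Real.rpow_add hd0]; ring_nf]
    ring
  rw [e1]
  exact mul_le_mul (Real.rpow_le_rpow_of_exponent_le hb (by linarith))
    (Real.rpow_le_rpow_of_exponent_le hd (by linarith)) (by positivity) (by positivity)

/-- `B D^{-(1/4 − ε'/2)} ≤ B^{1+ε} D^{-1/4}` for `d ≤ b`, `ε' ≤ 2ε`. [folklore] -/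
theorem expo_T4 {b d ε ε' : ℝ} (hb : 1 ≤ b) (hd : 1 ≤ d) (hdb : d ≤ b) (hε' : 0 ≤ ε')
    (hε'ε : ε' ≤ 2 * ε) :
    b * d ^ (-(1 / 4 - ε' / 2)) ≤ b ^ (1 + ε) * d ^ (-(1 / 4 : ℝ)) := by
  have hb0 : 0 < b := by linarith
  have hd0 : 0 < d := by linarith
  rw [show -(1 / 4 - ε' / 2) = -(1 / 4 : ℝ) + ε' / 2 by ring, Real.rpow_add hd0]
  have e1 : d ^ (ε' / 2) ≤ b ^ ε :=
    calc d ^ (ε' / 2) ≤ b ^ (ε' / 2) := Real.rpow_le_rpow hd0.le hdb (by positivity)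
      _ ≤ b ^ ε := Real.rpow_le_rpow_of_exponent_le hb (by linarith)
  calc b * (d ^ (-(1 / 4 : ℝ)) * d ^ (ε' / 2)) = b ^ (1 : ℝ) * d ^ (ε' / 2) * d ^ (-(1 / 4 : ℝ)) := by
        rw [Real.rpow_one]; ring
    _ ≤ b ^ (1 : ℝ) * b ^ ε * d ^ (-(1 / 4 : ℝ)) := by gcongr
    _ = b ^ (1 + ε) * d ^ (-(1 / 4 : ℝ)) := by rw [← Real.rpow_add hb0]

/-- `B (B^{1/4}D)^{κ−1} ≤ B^{1+ε} D^{-1/4}` for `0 ≤ κ ≤ 3/4`, `0 ≤ ε`. [folklore] -/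
theorem expo_T5 {b d ε κ : ℝ} (hb : 1 ≤ b) (hd : 1 ≤ d) (hε : 0 ≤ ε) (hκ : κ ≤ 3 / 4) :
    b * (b ^ (1 / 4 : ℝ) * d) ^ (-(1 - κ)) ≤ b ^ (1 + ε) * d ^ (-(1 / 4 : ℝ)) := by
  have hb0 : 0 < b := by linarith
  have hd0 : 0 < d := by linarith
  rw [S0_rpow_neg hb0.le hd0.le]
  calc b * (b ^ (-(1 - κ) / 4) * d ^ (-(1 - κ))) = b ^ (1 : ℝ) * b ^ (-(1 - κ) / 4) * d ^ (-(1 - κ)) := by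
        rw [Real.rpow_one]; ring
    _ = b ^ (1 + -(1 - κ) / 4) * d ^ (-(1 - κ)) := by rw [← Real.rpow_add hb0]
    _ ≤ b ^ (1 + ε) * d ^ (-(1 / 4 : ℝ)) :=
        mul_le_mul (Real.rpow_le_rpow_of_exponent_le hb (by linarith))
          (Real.rpow_le_rpow_of_exponent_le hd (by linarith)) (by positivity) (by positivity)

/-- The bracket `B^{1+ε}D^{-1/4} + B^{41/42+ε}D^{11/8}` is at least `1` for `1 ≤ D ≤ B`.
[folklore] -/
theorem one_le_bracket {b d ε : ℝ} (hb : 1 ≤ b) (hd : 1 ≤ d) (hdb : d ≤ b) (hε : 0 ≤ ε) :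
    1 ≤ b ^ (1 + ε) * d ^ (-(1 / 4 : ℝ)) ∧ 0 ≤ b ^ (41 / 42 + ε : ℝ) * d ^ (11 / 8 : ℝ) := by
  have hb0 : 0 < b := by linarith
  have hd0 : 0 < d := by linarith
  refine ⟨?_, by positivity⟩
  have h1 : b ^ (-(1 / 4 : ℝ)) ≤ d ^ (-(1 / 4 : ℝ)) :=
    Real.rpow_le_rpow_of_nonpos hd0 hdb (by norm_num)
  have h2 : (1 : ℝ) ≤ b ^ (1 + ε) * b ^ (-(1 / 4 : ℝ)) := by
    rw [← Real.rpow_add hb0]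
    exact Real.one_le_rpow hb (by linarith)
  exact h2.trans (mul_le_mul_of_nonneg_left h1 (by positivity))

/-! ### Small `B` -/

/-- The deviation `|N(D, B) − cB|`. [folklore] -/
def deviation (𝔠 : (Fin 4 → ℤ) → ℝ) (B D : ℕ) : ℝ := |(mainCountTrunc B D : ℝ) - cConst 𝔠 * B|

/-- `deviation ≥ 0`. [folklore] -/
theorem deviation_nonneg (𝔠 : (Fin 4 → ℤ) → ℝ) (B D : ℕ) : 0 ≤ deviation 𝔠 B D := abs_nonneg _

/-- A bound for `|N(D, B) − cB|` over `B, D < 128` (the sum of these finitely many values).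
[folklore] -/
def smallConst (𝔠 : (Fin 4 → ℤ) → ℝ) : ℝ := ∑ B ∈ range 128, ∑ D ∈ range 128, deviation 𝔠 B D

/-- `|N(D,B) − cB| ≤ smallConst` for `B, D < 128`. [folklore] -/
theorem le_smallConst (𝔠 : (Fin 4 → ℤ) → ℝ) {B D : ℕ} (hB : B < 128) (hD : D < 128) :
    |(mainCountTrunc B D : ℝ) - cConst 𝔠 * B| ≤ smallConst 𝔠 := by
  have h1 : deviation 𝔠 B D ≤ ∑ D' ∈ range 128, deviation 𝔠 B D' :=
    single_le_sum (f := fun D' => deviation 𝔠 B D') (fun x _ => deviation_nonneg 𝔠 B x)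
      (mem_range.2 hD)
  have h2 : ∑ D' ∈ range 128, deviation 𝔠 B D' ≤ smallConst 𝔠 :=
    single_le_sum (f := fun B' => ∑ D' ∈ range 128, deviation 𝔠 B' D')
      (fun x _ => sum_nonneg fun y _ => deviation_nonneg 𝔠 x y) (mem_range.2 hB)
  exact h1.trans h2

/-- `0 ≤ smallConst`. [folklore] -/
theorem smallConst_nonneg (𝔠 : (Fin 4 → ℤ) → ℝ) : 0 ≤ smallConst 𝔠 :=
  sum_nonneg fun x _ => sum_nonneg fun y _ => deviation_nonneg 𝔠 x y

/-! ### The truncated asymptotic -/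

/-- **The truncated asymptotic** `|N(D,B) − cB| ≤ C_ε (B^{1+ε}D^{-1/4} + B^{41/42+ε}D^{11/8})` for
`1 ≤ D ≤ B^{4/245}`, from the shapes of Theorem 4.2 and Lemma 4.15 — the hypothesis `hmain` of
`mainCount_sub_linear_le_of_truncated'`. This is §5 from (5.7) to the display before (5.10):
Theorem 4.2 summed over the `(d, 𝐲)` with `d₀ ≤ S₀ = B^{1/4}D` (error terms: Lemma 5.4; completed
main terms: Lemma 5.3), the pairs with `d₀ > S₀` by the trivial bound, and `B < 128` separately.
[cite: Shute2021, §5, (5.7)–(5.10), Lemmas 5.3–5.4] -/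
theorem truncated_asymptotic {𝔠 : (Fin 4 → ℤ) → ℝ} (h1 : CoeffBound 𝔠) (h2 : CircleMethodInput 𝔠) :
    ∀ ε : ℝ, 0 < ε → ∃ C : ℝ, ∀ B D : ℕ, 1 ≤ B → 1 ≤ D →
      (D : ℝ) ≤ (B : ℝ) ^ (4 / 245 : ℝ) →
        |(mainCountTrunc B D : ℝ) - cConst 𝔠 * B| ≤
          C * ((B : ℝ) ^ (1 + ε) * (D : ℝ) ^ (-(1 / 4 : ℝ)) +
            (B : ℝ) ^ (41 / 42 + ε : ℝ) * (D : ℝ) ^ (11 / 8 : ℝ)) := by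
  intro ε hε
  classical
  -- parameters `ε' = min(ε, 1/100)`, `ε₁ = δ = ε'/100`, `κ = ε'`, `η = 1/4 − ε'/2`
  obtain ⟨ε', hε'def⟩ : ∃ ε' : ℝ, ε' = min ε (1 / 100) := ⟨_, rfl⟩
  have hε'0 : 0 < ε' := by rw [hε'def]; exact lt_min hε (by norm_num)
  have hε'ε : ε' ≤ ε := by rw [hε'def]; exact min_le_left _ _
  have hε'1 : ε' ≤ 1 / 100 := by rw [hε'def]; exact min_le_right _ _
  obtain ⟨ε₁, hε₁def⟩ : ∃ ε₁ : ℝ, ε₁ = ε' / 100 := ⟨_, rfl⟩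
  have hε₁0 : 0 < ε₁ := by rw [hε₁def]; positivity
  have hθ' : 11 * ε₁ + ε₁ < 1 / 4 := by rw [hε₁def]; linarith
  have hη0 : 0 ≤ 1 / 4 - ε' / 2 := by linarith
  have hθ : 11 * ε₁ + ε₁ + (1 / 4 - ε' / 2) < 1 / 4 := by rw [hε₁def]; linarith
  -- constants
  obtain ⟨C₁, hC₁⟩ := h1 ε₁ hε₁0
  obtain ⟨C₂, hC₂⟩ := h2 ε' hε'0
  obtain ⟨Cd, hCd1, hCd⟩ :=
    Literature.NumberTheory.Sieve.exists_card_divisors_le_mul_rpow (ε := ε₁) hε₁0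
  obtain ⟨Cw, hCw0, hCw⟩ := exists_sum_weight_le hθ'
  obtain ⟨Ct, hCt0, hCt⟩ := exists_sum_weight_tail_le hη0 hθ
  obtain ⟨Z₂, hZ₂0, hZ₂⟩ := exists_sum_rpow_neg_le (s := 2) (by norm_num)
  obtain ⟨Zt, hZt0, hZt⟩ :=
    exists_sum_rpow_neg_tail_le (s₁ := 1 + ε') (s₂ := 1 - ε') (by linarith) (by linarith)
  obtain ⟨Zt3, hZt30, hZt3⟩ :=
    exists_sum_rpow_neg_tail_le (s₁ := 1 + ε') (s₂ := 2 - ε') (by linarith) (by linarith)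
  obtain ⟨Z₄, hZ₄0, hZ₄⟩ := exists_sum_rpow_neg_le (s := 2 * (41 / 42 + ε')) (by linarith)
  obtain ⟨Cy, hCy0, hCy⟩ := exists_card_le_rpow (δ := ε₁) hε₁0
  have hsum := summable_cTerm h1
  have hCd0 : 0 ≤ Cd := by linarith
  -- the constant
  obtain ⟨K, hKdef⟩ : ∃ K : ℝ, K = max C₂ 0 / 16 * Z₄ * (Cd * Cy) + max C₁ 0 / 16 * (Cd * Cy) +
      Zt3 * (Cd * Cy) + max C₁ 0 * Cd * (Z₂ * Ct) / 16 + max C₁ 0 * Cd * (Zt * Cw) / 16 := ⟨_, rfl⟩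
  have hK0 : 0 ≤ K := by rw [hKdef]; positivity
  refine ⟨max K (smallConst 𝔠), fun B D hB hD hDB => ?_⟩
  have hB1 : (1 : ℝ) ≤ B := by exact_mod_cast hB
  have hB0 : (0 : ℝ) < B := by linarith
  have hD1 : (1 : ℝ) ≤ D := by exact_mod_cast hD
  have hD0 : (0 : ℝ) < D := by linarith
  have hDB' : (D : ℝ) ≤ B := hDB.trans (by
    calc (B : ℝ) ^ (4 / 245 : ℝ) ≤ (B : ℝ) ^ (1 : ℝ) :=
          Real.rpow_le_rpow_of_exponent_le hB1 (by norm_num)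
      _ = B := Real.rpow_one _)
  obtain ⟨hX1, hY0⟩ := one_le_bracket hB1 hD1 hDB' hε.le
  -- small `B`
  by_cases hB128 : B < 128
  · have hD128 : D < 128 := by
      have : (D : ℝ) < 128 := lt_of_le_of_lt hDB' (by exact_mod_cast hB128)
      exact_mod_cast this
    calc |(mainCountTrunc B D : ℝ) - cConst 𝔠 * B| ≤ smallConst 𝔠 * 1 := by
          rw [mul_one]; exact le_smallConst 𝔠 hB128 hD128
      _ ≤ max K (smallConst 𝔠) * ((B : ℝ) ^ (1 + ε) * (D : ℝ) ^ (-(1 / 4 : ℝ)) +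
            (B : ℝ) ^ (41 / 42 + ε : ℝ) * (D : ℝ) ^ (11 / 8 : ℝ)) :=
          mul_le_mul (le_max_right _ _) (by linarith) zero_le_one
            (le_max_of_le_right (smallConst_nonneg 𝔠))
  have h128 : 128 ≤ B := not_lt.1 hB128
  -- the index sets and the decomposition of `N(D,B) − cB`
  obtain ⟨S₀, hS₀def⟩ : ∃ S₀ : ℝ, S₀ = (B : ℝ) ^ (1 / 4 : ℝ) * D := ⟨_, rfl⟩
  have hS₀0 : 0 < S₀ := by rw [hS₀def]; positivity
  obtain ⟨T, hTdef⟩ : ∃ T : ℝ, T = ∑ y ∈ yVectors B D, (#((∏ i, y i).natAbs.divisors) : ℝ) :=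
    ⟨_, rfl⟩
  have hT : T ≤ Cd * Cy * (D : ℝ) ^ (1 + 2 * ε₁) := by
    rw [hTdef]; exact sum_card_divisors_yVectors_le hε₁0 hCd hCy B D
  have hW₁ : ∀ p, Adm p → (∏ i, p.2 i).natAbs ≤ D → (dFree p.1 p.2 : ℝ) ≤ S₀ →
      p ∈ (dRange B ×ˢ yVectors B D).filter (fun p => (dFree p.1 p.2 : ℝ) ≤ S₀) := by
    intro p hadm hYD hdS
    rw [mem_filter]
    exact ⟨mem_pairs_of_adm hB hDB hadm hYD (by rw [← hS₀def]; exact hdS), hdS⟩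
  have hdecomp : (mainCountTrunc B D : ℝ) - cConst 𝔠 * B =
      ∑ p ∈ dRange B ×ˢ yVectors B D with (dFree p.1 p.2 : ℝ) ≤ S₀,
          (muPair p * Npair B p - (B : ℝ) / 16 * cTerm 𝔠 p) +
        ∑ p ∈ dRange B ×ˢ yVectors B D with ¬ (dFree p.1 p.2 : ℝ) ≤ S₀, muPair p * Npair B p -
        (B : ℝ) / 16 * (∑' p, cTerm 𝔠 p -
          ∑ p ∈ dRange B ×ˢ yVectors B D with (dFree p.1 p.2 : ℝ) ≤ S₀, cTerm 𝔠 p) := by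
    rw [mainCountTrunc_eq_sum_pairs, ← sum_filter_add_sum_filter_not (dRange B ×ˢ yVectors B D)
      (fun p => (dFree p.1 p.2 : ℝ) ≤ S₀), cConst, sum_sub_distrib, ← mul_sum]
    ring
  -- the three estimates
  have hsum1 := sum_local_le hε'0 hε₁0 (by rw [hε₁def]; linarith) hC₁ hC₂ hZ₄ h128 hD hDB
  rw [← hS₀def, ← hTdef] at hsum1
  have hsum2 := sum_tail_Npair_le hZt3 B D S₀ hS₀0
  rw [← hTdef] at hsum2
  have hsum3 := const_tail_le hε₁0 hC₁ hCd hCw hCt hZ₂ hZt hsum D hD S₀ hS₀0 _ hW₁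
  -- names for the bracket terms
  obtain ⟨X, hXdef⟩ : ∃ X : ℝ, X = (B : ℝ) ^ (1 + ε) * (D : ℝ) ^ (-(1 / 4 : ℝ)) := ⟨_, rfl⟩
  obtain ⟨Y, hYdef⟩ : ∃ Y : ℝ, Y = (B : ℝ) ^ (41 / 42 + ε : ℝ) * (D : ℝ) ^ (11 / 8 : ℝ) := ⟨_, rfl⟩
  have hX0 : 0 ≤ X := by rw [hXdef]; positivity
  rw [← hYdef] at hY0
  -- exponent bookkeeping
  have hT1 : max C₂ 0 / 16 * (Z₄ * (B : ℝ) ^ (41 / 42 + ε' : ℝ) * T) ≤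
      max C₂ 0 / 16 * Z₄ * (Cd * Cy) * Y := by
    have e := expo_T1 (b := (B : ℝ)) (d := (D : ℝ)) (δ := ε₁) hB1 hD1 hε'ε (by rw [hε₁def]; linarith)
    rw [← hYdef] at e
    calc max C₂ 0 / 16 * (Z₄ * (B : ℝ) ^ (41 / 42 + ε' : ℝ) * T)
        ≤ max C₂ 0 / 16 * (Z₄ * (B : ℝ) ^ (41 / 42 + ε' : ℝ) * (Cd * Cy * (D : ℝ) ^ (1 + 2 * ε₁))) := by
          gcongr
      _ = max C₂ 0 / 16 * Z₄ * (Cd * Cy) * ((B : ℝ) ^ (41 / 42 + ε' : ℝ) * (D : ℝ) ^ (1 + 2 * ε₁)) := by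
          ring
      _ ≤ _ := mul_le_mul_of_nonneg_left e (by positivity)
  have hT2 : max C₁ 0 / 16 * (S₀ * T) ≤ max C₁ 0 / 16 * (Cd * Cy) * Y := by
    have e := expo_T2 (b := (B : ℝ)) (d := (D : ℝ)) (δ := ε₁) hB1 hD1 hDB hε hε₁0.le
      (by rw [hε₁def]; linarith)
    rw [← hYdef] at e
    calc max C₁ 0 / 16 * (S₀ * T) ≤ max C₁ 0 / 16 * (S₀ * (Cd * Cy * (D : ℝ) ^ (1 + 2 * ε₁))) := by
          gcongr
      _ = max C₁ 0 / 16 * (Cd * Cy) * ((B : ℝ) ^ (1 / 4 : ℝ) * D * (D : ℝ) ^ (1 + 2 * ε₁)) := by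
          rw [hS₀def]; ring
      _ ≤ _ := mul_le_mul_of_nonneg_left e (by positivity)
  have hT3 : Zt3 * S₀ ^ (-(2 - ε')) * (B : ℝ) ^ (3 / 2 : ℝ) * T ≤ Zt3 * (Cd * Cy) * X := by
    have e := expo_T3 (b := (B : ℝ)) (d := (D : ℝ)) (ε := ε) (κ := ε') (δ := ε₁) hB1 hD1
      (by linarith) (by rw [hε₁def]; linarith)
    rw [← hXdef] at e
    calc Zt3 * S₀ ^ (-(2 - ε')) * (B : ℝ) ^ (3 / 2 : ℝ) * T
        ≤ Zt3 * S₀ ^ (-(2 - ε')) * (B : ℝ) ^ (3 / 2 : ℝ) * (Cd * Cy * (D : ℝ) ^ (1 + 2 * ε₁)) := by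
          gcongr
      _ = Zt3 * (Cd * Cy) * (((B : ℝ) ^ (1 / 4 : ℝ) * D) ^ (-(2 - ε')) * (B : ℝ) ^ (3 / 2 : ℝ) *
            (D : ℝ) ^ (1 + 2 * ε₁)) := by rw [hS₀def]; ring
      _ ≤ _ := mul_le_mul_of_nonneg_left e (by positivity)
  have hT4 : (B : ℝ) / 16 * (max C₁ 0 * Cd * Z₂ * Ct * (D : ℝ) ^ (-(1 / 4 - ε' / 2))) ≤
      max C₁ 0 * Cd * (Z₂ * Ct) / 16 * X := by
    have e := expo_T4 (b := (B : ℝ)) (d := (D : ℝ)) (ε := ε) (ε' := ε') hB1 hD1 hDB' hε'0.le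
      (by linarith)
    rw [← hXdef] at e
    calc (B : ℝ) / 16 * (max C₁ 0 * Cd * Z₂ * Ct * (D : ℝ) ^ (-(1 / 4 - ε' / 2)))
        = max C₁ 0 * Cd * (Z₂ * Ct) / 16 * ((B : ℝ) * (D : ℝ) ^ (-(1 / 4 - ε' / 2))) := by ring
      _ ≤ _ := mul_le_mul_of_nonneg_left e (by positivity)
  have hT5 : (B : ℝ) / 16 * (max C₁ 0 * Cd * Zt * Cw * S₀ ^ (-(1 - ε'))) ≤
      max C₁ 0 * Cd * (Zt * Cw) / 16 * X := by
    have e := expo_T5 (b := (B : ℝ)) (d := (D : ℝ)) (ε := ε) (κ := ε') hB1 hD1 hε.le (by linarith)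
    rw [← hXdef] at e
    calc (B : ℝ) / 16 * (max C₁ 0 * Cd * Zt * Cw * S₀ ^ (-(1 - ε')))
        = max C₁ 0 * Cd * (Zt * Cw) / 16 * ((B : ℝ) * ((B : ℝ) ^ (1 / 4 : ℝ) * D) ^ (-(1 - ε'))) := by
          rw [hS₀def]; ring
      _ ≤ _ := mul_le_mul_of_nonneg_left e (by positivity)
  -- conclusion
  have hc10 : 0 ≤ max C₂ 0 / 16 * Z₄ * (Cd * Cy) := by positivity
  have hc20 : 0 ≤ max C₁ 0 / 16 * (Cd * Cy) := by positivity
  have hc30 : 0 ≤ Zt3 * (Cd * Cy) := by positivity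
  have hc40 : 0 ≤ max C₁ 0 * Cd * (Z₂ * Ct) / 16 := by positivity
  have hc50 : 0 ≤ max C₁ 0 * Cd * (Zt * Cw) / 16 := by positivity
  have hsplit : (B : ℝ) / 16 * (max C₁ 0 * Cd * Z₂ * Ct * (D : ℝ) ^ (-(1 / 4 - ε' / 2)) +
        max C₁ 0 * Cd * Zt * Cw * S₀ ^ (-(1 - ε'))) =
      (B : ℝ) / 16 * (max C₁ 0 * Cd * Z₂ * Ct * (D : ℝ) ^ (-(1 / 4 - ε' / 2))) +
        (B : ℝ) / 16 * (max C₁ 0 * Cd * Zt * Cw * S₀ ^ (-(1 - ε'))) := by ring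
  have hKXY : max C₂ 0 / 16 * Z₄ * (Cd * Cy) * Y + max C₁ 0 / 16 * (Cd * Cy) * Y +
        Zt3 * (Cd * Cy) * X +
        (max C₁ 0 * Cd * (Z₂ * Ct) / 16 * X + max C₁ 0 * Cd * (Zt * Cw) / 16 * X) ≤
      K * (X + Y) := by
    have e : K * (X + Y) - (max C₂ 0 / 16 * Z₄ * (Cd * Cy) * Y + max C₁ 0 / 16 * (Cd * Cy) * Y +
        Zt3 * (Cd * Cy) * X +
        (max C₁ 0 * Cd * (Z₂ * Ct) / 16 * X + max C₁ 0 * Cd * (Zt * Cw) / 16 * X)) =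
        max C₂ 0 / 16 * Z₄ * (Cd * Cy) * X + max C₁ 0 / 16 * (Cd * Cy) * X +
          Zt3 * (Cd * Cy) * Y +
          (max C₁ 0 * Cd * (Z₂ * Ct) / 16 * Y + max C₁ 0 * Cd * (Zt * Cw) / 16 * Y) := by
      rw [hKdef]; ring
    linarith only [e, mul_nonneg hc10 hX0, mul_nonneg hc20 hX0, mul_nonneg hc30 hY0,
      mul_nonneg hc40 hY0, mul_nonneg hc50 hY0]
  have hfinal : |(mainCountTrunc B D : ℝ) - cConst 𝔠 * B| ≤ K * (X + Y) := by
    rw [hdecomp]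
    refine (abs_sub _ _).trans ?_
    refine (add_le_add ((abs_add_le _ _).trans (add_le_add
      ((abs_sum_le_sum_abs _ _).trans hsum1) ((abs_sum_le_sum_abs _ _).trans hsum2))) (show
        |(B : ℝ) / 16 * (∑' p, cTerm 𝔠 p -
          ∑ p ∈ dRange B ×ˢ yVectors B D with (dFree p.1 p.2 : ℝ) ≤ S₀, cTerm 𝔠 p)| ≤
        (B : ℝ) / 16 * (max C₁ 0 * Cd * Z₂ * Ct * (D : ℝ) ^ (-(1 / 4 - ε' / 2)) +
          max C₁ 0 * Cd * Zt * Cw * S₀ ^ (-(1 - ε'))) from by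
        rw [abs_mul, abs_of_nonneg (by positivity : (0 : ℝ) ≤ (B : ℝ) / 16)]
        exact mul_le_mul_of_nonneg_left hsum3 (by positivity))).trans ?_
    rw [hsplit]
    linarith only [hT1, hT2, hT3, hT4, hT5, hKXY]
  rw [← hXdef, ← hYdef]
  exact hfinal.trans (mul_le_mul_of_nonneg_right (le_max_left _ _) (by linarith))

/-- **Theorem 1.1 of Shute (2021) from Prop. 3.1 and the circle-method input.** If Prop. 3.1
holds (named fact `Shute2021_prop31`, reduced to Prop. 3.2 in `ShuteFourSquarefulProofs.lean`),
if the counts `N_𝐚(B)` of (1.6) satisfy the asymptotic of Theorem 4.2 with a main-term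
coefficient `𝔠(𝐚)` obeying the bound of Lemma 4.15 (`CircleMethodInput`, `CoeffBound`; in the
paper `𝔠(𝐚) = 𝔖_𝐚 σ_∞(𝛆)`), and if the resulting constant `c = cConst 𝔠` (the corrected (5.10)) is
positive (Lemma 5.5), then `N(B) = cB + O_ε(B^{734/735+ε})`, i.e. `Shute2021_theorem11`. What is
thereby NOT formalized is exactly §4 (Theorem 4.2, Lemma 4.15), Lemma 5.5 / `c > 0`, and Prop. 3.2.
[cite: Shute2021, Theorem 1.1; §5] -/
theorem theorem11_of_circleMethod (h31 : Shute2021_prop31) (𝔠 : (Fin 4 → ℤ) → ℝ)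
    (h1 : CoeffBound 𝔠) (h2 : CircleMethodInput 𝔠) (hc : 0 < cConst 𝔠) :
    Shute2021_theorem11 :=
  ⟨cConst 𝔠, hc, mainCount_sub_linear_le_of_truncated' h31 (truncated_asymptotic h1 h2)⟩

/-- **Theorem 1.1 of Shute (2021) from Prop. 3.2 and the circle-method input** — the paper's own
logical structure (Prop. 3.2 ⟹ Prop. 3.1, `Shute2021_prop32.prop31` of
`ShuteFourSquarefulProofs.lean`; then `theorem11_of_circleMethod`). The printed proof of Prop. 3.2
is incomplete (see `ShuteFourSquareful.lean`, `ShuteFourSquarefulPrintedL.lean`), which is why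
`Shute2021_theorem11` remains a claim. [cite: Shute2021, Theorem 1.1; §3, §5] -/
theorem theorem11_of_prop32_and_circleMethod (h32 : Shute2021_prop32) (𝔠 : (Fin 4 → ℤ) → ℝ)
    (h1 : CoeffBound 𝔠) (h2 : CircleMethodInput 𝔠) (hc : 0 < cConst 𝔠) :
    Shute2021_theorem11 :=
  theorem11_of_circleMethod (Shute2021_prop32.prop31 h32) 𝔠 h1 h2 hc

end Shute2021

end Literature.NumberTheory.DiophantineGeometry
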